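import Summits.BirchSwinnertonDyer.BirchSwinnertonDyer.Theorems.EisensteinPrimesBSDpOnCellCResidualV11
import Literature.NumberTheory.EllipticCurves.TwoVariableSelmerDual
import HarnessLib

/-!
# Crux 4 `BSDpOnCellC` (stmt-BirchSwinnertonDyer-19034) — line «accum» v1.5 (ideator `bsd-idea-12` g15, lens = embed;
# UNREGISTERED crux workfile, W-79: the skeleton OF RECORD stays b1 v12 `155e218d…`; nothing here is served)

WHAT THIS LINE IS. The b1 v12 record closes crux 4 BY NAME from six stubs; exactly one of them, `stub_divRbeta`
(road R-β at `𝔭̄`, both signs: `∃ k, p^k·Q ∈ Ch_Λ(X_ac^∅ strict at 𝔭̄)·𝓞_{ℂ_p}⟦T⟧` for every ♭-frame `Q`,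
`X2.NonsplitKolyvaginDivOnTreeIntOther` / `X2.SplitKolyvaginDivOnTreeIntOther`), is the RATIONAL Kolyvagin-direction
divisibility that no printed Euler/Kolyvagin system delivers at a residually REDUCIBLE `p ‖ N` (Keller–Yin §3 `Koly`,
CGS 2025 §6 and Castella arXiv:2409.01360 all carry `p ∤ N`; the cell's road H gives only the REVERSE divisibility).
This file keeps the other five record stubs BYTE-IDENTICAL and replaces `stub_divRbeta` by TWO stubs through a
sign-free two-variable intermediate over the `ℤ_p²`-tower `K̃_∞`:

* `stub_twoVarRatDivPNew` — `TwoVarRatDivPNew W p` (defined below): at every X2c datum (the binders of R-β WITHOUT the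
  sign), for the (cyclotomic, anticyclotomic) pair `(κ₁, κ)` with an adapted generator pair `(γ₁, γ)`, SOME two-variable
  lift `L₂ ∈ 𝓞_{ℂ_p}⟦T₁⟧⟦T₂⟧` of the ♭-frame (`L₂(0, T) · u = p^e · Q`, `u` a unit) satisfies
  `p^c · L₂ ∈ ch_{Λ₂}(X_Gr(E_K/K̃_∞) unramified above 𝔭̄)·𝓞_{ℂ_p}⟦T₁⟧⟦T₂⟧` (tree carrier `WeierstrassCurve.XGr₂`,
  `XGr₂.charIdeal`, Burungale–Castella–Skinner's `X_Gr`; the descent `Λ₂ → Λ` along the `κ`-line IS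
  `PowerSeries.constantCoeff`, `Rubin1991/TwoVariableMainConjecture.lean` §5). INTENDED PROOF = THE LEVER OF THIS LINE
  (idea card `Ideas/accum.md`): RATIONAL ACCUMULATION ALONG THE WEIGHT VARIABLE — the pure-algebra
  `AccumulationLemma₂` below (stated sorry-free as a `def`, NOT a stub, to respect the ≤ 7 cut — and, v1.4, PROVED IN FULL
  in §0a: `accumulationLemma₂_holds : AccumulationLemma₂ p`, `accumulationLemma₂U_holds : AccumulationLemma₂U p`, sorry-free,
  standard axioms, no library input beyond Mathlib — in particular NO unique factorisation) applied
  to (i) the member-wise rational two-variable Beilinson–Flach Kolyvagin divisibilities of the CRYSTALLINE members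
  `g_k` (weight `k ≡ 2 mod (p−1)p^m`, tame level `N/p`, GOOD ordinary at `p`, residually reducible; image-free
  hypotheses (i)(ii) of Rubin's `Hyp(K_∞, V)` = CGS 2025 Thm. 3.3.1's) of the Hida family through `f_E`, (ii) fibre
  control of the family Greenberg Selmer module over `𝕀⟦Γ_K⟧` on `f_E`'s étale branch (`𝕀 ⊗ ℚ` is étale over the
  weight algebra at the `p`-new weight-2 point: multiplicity one + the Weil bound excludes `U_p`-eigenvalue `±1` on
  `p`-old forms), and (iii) the analytic fibre: the members' Greenberg/BDP functions converge to `f_E`'s ♭-frame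
  (Castella JIMJ 19 (2020) Thm. 1.4; at weight 2 `p`-new: `Castella2018Exceptional` Thms. 2.10–2.11 = the record's
  registered fact `thm210_thm211_bdpDisplay_pNew`). The weights `k` ACCUMULATE `p`-ADICALLY at `2`; Zariski density of
  the members is NOT enough (counterexample in the docstring of `AccumulationLemma₂`). No Beilinson–Flach class, no
  reciprocity law and no Kolyvagin system is ever needed AT the `p`-new point (the cell's residual R9 / C2(b)), and no
  lattice, congruence module or `μ`-invariant enters (the cell's R8): the statement is rational and `p^c` is free.
* `stub_acDescent` — `TwoVarRatDivPNew ⟹ R-β` (both signs): descent of the two-variable divisibility to the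
  anticyclotomic line `T₁ = 0`: `π(ch_{Λ₂} X_Gr) ⊆ p^{-k}·ch_Λ(X_ac^∅ strict at 𝔭̄)` needs `X_Gr(E'/K̃_∞)[T₁]` FINITE for
  the isogenous member `E'` with `E'(K)[p] = 0` (Greenberg 2016 Prop. 4.1.1 shape — no nonzero pseudo-null
  submodule; at `p ‖ N` with the (∅ at `𝔭`, unramified at `𝔭̄`) condition this is NOT in print), the local descent errors
  at `w ∣ 𝔭̄` and `w ∣ N` being finite (`μ_{p^∞}(K^{ac}_{∞,w})` finite) and isogeny invariance of `ch_Λ` up to `p^j`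
  — all absorbed by the free `p^k` of R-β.

COMPOSITION: `BSDpOnCellC_of` = the record's V11 closer with `divRbeta := stub_acDescent stub_twoVarRatDivPNew`;
`lean check` rc 0, sorries ONLY in the seven `stub_*`. Stub count 7 = 5 record (verbatim) + 2 new.

HONEST FRAMING (cell `bsd-eis`, run/shared/lean/pub/bsd-eis/; ideator HOME run/shared/lean/pub/ideators/bsd-idea-12/):
an UNREGISTERED crux workfile by an ideator seat (W-71/W-79: no route, no `skeleton check`); nothing is booked; X2
stays CONSTRUCTION-SHAPED; no label or count moves; the new stubs are HYPOTHESIS-SHAPED and their print status is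
stated above (member inputs at good `p`: assembled from printed pieces, not printed as stated; control and descent at
`p ‖ N`: unprinted). No summit statement — and no conjunct of BSD — is proved by this seat or by this file.
-/

set_option autoImplicit false
set_option linter.dupNamespace false

noncomputable section

open scoped Classical MatrixGroups ModularForm

open CongruenceSubgroup WeierstrassCurve NumberField IsDedekindDomain Field PowerSeries
  Literature.NumberTheory.EllipticCurves Literature.NumberTheory.EllipticCurves.GreenbergSelmer
  Literature.NumberTheory.EllipticCurves.ModularForms Literature.NumberTheory.QuadraticFields
  Literature.NumberTheory.EllipticCurves.Rank1Residual
  Literature.NumberTheory.EllipticCurves.Rank1Residual.Typed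
  Literature.NumberTheory.EllipticCurves.KrizLi2019
  Literature.NumberTheory.EllipticCurves.GreenbergVatsal2000
  Literature.NumberTheory.EllipticCurves.Wuthrich2014
  Literature.NumberTheory.EllipticCurves.SteinWuthrich2013
  Literature.NumberTheory.EllipticCurves.Castella2018Exceptional
  Literature.NumberTheory.GaloisRepresentations Literature.NumberTheory.GaloisCohomology
  Literature.NumberTheory.Automorphic
  Summit.BirchSwinnertonDyer.Rank1Residual.X11b.AcSelmer
  Summit.BirchSwinnertonDyer.Rank1Residual.X11b.Halves
  Summit.BirchSwinnertonDyer.Rank1Residual.X11b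
  Summit.BirchSwinnertonDyer.Rank1Residual Summit.BirchSwinnertonDyer.Rank1Residual.X1
  Summit.BirchSwinnertonDyer.Rank1Residual.X2
open Literature.NumberTheory.EllipticCurves.KellerYin2024 (curveLocalLambda)



namespace Summit.BirchSwinnertonDyer.BirchSwinnertonDyer.Cruxes.BSDpOnCellC.Accum

/-! ## §0 The lever, stated sorry-free (documentary `def`s; PROVED in §0a — `accumulationLemma₂_holds`, `accumulationLemma₂U_holds`) -/

/-- **`AccumulationLemma₂ p` — rational divisibility ACCUMULATES along a `p`-adically convergent sequence of
weight fibres.** Let `𝒪` be a complete discrete valuation ring in which `p` stays prime (a `ℤ_p`-algebra; meant: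
`ℤ_p` or `W(𝔽̄_p)`), `R := 𝒪⟦X⟧⟦T₂⟧⟦T₁⟧` (innermost variable `X` = the weight variable, `T₁, T₂` = the
`ℤ_p²`-tower variables), and for `y ∈ pℤ_p` write `[X − y] := C (C (X − C y)) ∈ R`. Let `F, L ∈ R`, let
`x : ℕ → ℤ_p`, `x_∞ ∈ ℤ_p` with `‖x_k‖ < 1`, `‖x_∞‖ < 1`, `x_k ≠ x_∞`, `x_k → x_∞`, and suppose that for every
`k` the fibre of `F` at `x_k` divides a `p`-power times the fibre of `L`: `∃ G U, p^{c_k}·L = F·G + [X − x_k]·U`.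
If the limit fibre of `F` is nonzero (`[X − x_∞] ∤ F`), then `∃ a G U, p^a·L = F·G + [X − x_∞]·U`.
PROOF (= the kernel proof `dvd_limit_of_members`, v1.4; NO unique factorisation): write `S := 𝒪⟦T₂⟧⟦T₁⟧` for the
fibre ring and `H(y) := Ev_y H ∈ S` (Weierstrass division by `X − y`). If `L(x_∞) = 0` take `a = 0`. Else decompose by
`p`-CONTENT: `F(x_∞) = p^b·F'`, `L(x_∞) = p^e·L'` with `F', L'` of unit content (some coefficient a unit); since
`(𝒪/p)⟦T₂⟧⟦T₁⟧` is a domain, a unit-content series is a NON-ZERO-DIVISOR modulo every `p^m`. For `k` with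
`p^n ∣ x_k − x_∞`, `n > j + b + e`, all coefficients of `F(x_k) − F(x_∞)` and `L(x_k) − L(x_∞)` are divisible by `p^n`, so
`F(x_k) = p^b·F'_k`, `L(x_k) = p^e·L'_k` with `F'_k ≡ F'`, `L'_k ≡ L'` modulo `p^{j+1}` (unit content again). The member
identity evaluated at `x_k` reads `p^{c_k+e}·L'_k = F'_k·(p^b·Q_k)`; as `F'_k` is a non-zero-divisor mod `p^{c_k+e}`,
`p^{c_k+e} ∣ p^b·Q_k`, and cancelling gives the EXACT identity `F'_k·W_k = L'_k` — the varying constant has disappeared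
into the content of `Q_k`. Hence `F'·W_k ≡ L' (mod p^j)`: the equation `F'·Z = L'` is solvable modulo every `p^j`, so
(SOLVING LEMMA `exists_mul_eq_of_forall_exists_mod`: the solutions are unique modulo `p^{j}` up to the non-zero-divisor,
hence Cauchy; `𝒪` is complete) solvable: `F'·Z = L'`, i.e. `F(x_∞)·(p^e Z) = p^b·L(x_∞)`, and lifting `p^e Z` constantly in
`X` gives `p^b·L − F·G ∈ ker Ev_{x_∞} = ([X − x_∞])`,
whence `F_∞ ∣ p^a·L_∞`. NECESSITY OF ACCUMULATION: `F = [X − x_∞] + p·C(C(C 1))·T₁`-type examples with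
`v_p(x_k − x_∞) = 1` for all `k` satisfy the hypothesis with `L = 1`, `c_k = 1` on a Zariski-dense set of fibres
and violate the conclusion.
PROOF STATUS (v1.4): **PROVED** — `accumulationLemma₂_holds : AccumulationLemma₂ p` (§0a Theorem P
`dvd_limit_of_members`; sorry-free; axioms `propext`, `Classical.choice`, `Quot.sound`; no input beyond Mathlib). History:
v1.2 (critic V95 price P1) proved the closedness half (Theorem A `exists_eq_C_C_pow_mul_unit_of_coeff_adic_limit`), the
fibre calculus `evAt`/`EvAt` (Mathlib `Polynomial.IsDistinguishedAt.algEquivQuotient` + `Polynomial.quotientSpanXSubCAlgEquiv`)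
and Theorem U₁, and NAMED unique factorisation of `𝒪⟦X⟧⟦T₂⟧⟦T₁⟧` (`UFDInput`) as the remaining input of a gcd / height-two
argument; v1.3 proved the uniform variant outright by the solving lemma; v1.4 proves the lemma itself by content
decomposition + non-zero-divisor cancellation + the solving lemma and DELETES `UFDInput` (never needed).
NEAREST PRIOR ART (found g15, corpus): Büyükboduk–Lei, arXiv:2008.08411 App. A Prop. 25 («a divisibility criterion in
regular rings», used in their Thm. 3.11 to PATCH member-wise Beilinson–Flach divisibilities at infinitely many crystalline
CHARACTER specialisations `ψ_i` into a three-variable divisibility over `Λ_𝐟(Γ_K)`, residually IRREDUCIBLE `ρ̄_𝐟`): there the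
fibre divisibilities are EXACT (`F ∣ G mod f_i`), the fibres `f_i` are merely infinitely many and pairwise coprime, the
hypothesis `ϖ ∤ F·G` (no `p`-content) is imposed and the member constant `ϖ^s`, `s = sup s(ψ_i) < ∞`, must be UNIFORM and is
stripped by a `μ`-normalisation before patching. The present lemma is the RATIONAL sibling: VARYING constants `p^{c_k}`, NO
hypothesis on `p`-contents (at an Eisenstein prime `μ > 0` does occur — `Literature.Barriers.BirchSwinnertonDyer.
EisensteinMuConjecture` — so `ϖ ∤ F` is not available on cell C), conclusion up to `p^a` (R-β's free currency); the price is
`p`-ADIC ACCUMULATION of the fibres instead of Zariski-infinitude (necessary, by the example above), and the use is DOWNWARD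
(family ⟹ the `p`-new weight-two member) rather than upward.
UNIFORM VARIANT (documentary remark, same proof + one line): if moreover `c_k ≤ c` for all `k`, the nondegeneracy
hypothesis `[X − x_∞] ∤ F` FOLLOWS from `[X − x_∞] ∤ L` — for `[X − x_∞] ∣ F` gives `p^{v_p(x_k − x_∞)} ∣ F(x_k) ∣ p^c·L(x_k)`,
so `L(x_k) → 0` coefficientwise while `L(x_k) → L(x_∞) ≠ 0`. In the application `L(x_∞)` is the two-variable Greenberg/BDP
function of `f_E`, nonzero in rank one (its `κ`-line restriction is the ♭-frame `Q ≠ 0`), so with uniform member constants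
the `Λ₂`-TORSION of `X_Gr(f_E/K̃_∞)` (the first clause of `TwoVarRatDivPNew`) is an OUTPUT of accumulation, not an input;
uniformity of the rational Euler-system constant along the non-CM branch is then the named extra input (Λ-adic open image:
Hida, Invent. Math. 2013 / Compositio Math. 151 (2015); continuity of the local terms). THIS REMARK IS NOW A THEOREM, AND SO IS
THE WHOLE UNIFORM VARIANT (v1.3): `not_dvd_of_uniform_members` (§0a, Theorem U₁), `dvd_limit_of_uniform_members` (Theorem U₂)
and `accumulationLemma₂U_holds : AccumulationLemma₂U p` — sorry-free, no UFD input.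
[cite: BuyukbodukLei2020, App. A Prop. 25 and Thm. 3.11 (arXiv:2008.08411 pp. 44 and 51)]
[cite: Ochiai2006, §7 Def. 7.1 and Lemma 7.2 (Compositio Math. 142, pp. 1187–1188: the pseudo-null obstruction to
specialising two-variable Iwasawa modules at height-one primes — the phenomenon this lemma bypasses rationally)] -/
def AccumulationLemma₂ (p : ℕ) [Fact p.Prime] : Prop :=
  ∀ (𝒪 : Type) [CommRing 𝒪] [IsDomain 𝒪] [IsDiscreteValuationRing 𝒪] [Algebra ℤ_[p] 𝒪],
    IsAdicComplete (IsLocalRing.maximalIdeal 𝒪) 𝒪 → Irreducible ((p : ℕ) : 𝒪) →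
    ∀ (F L : PowerSeries (PowerSeries (PowerSeries 𝒪))) (x : ℕ → ℤ_[p]) (xlim : ℤ_[p]) (c : ℕ → ℕ),
      (∀ k, ‖x k‖ < 1) → ‖xlim‖ < 1 → (∀ k, x k ≠ xlim) → Filter.Tendsto x Filter.atTop (nhds xlim) →
      (∀ k, ∃ G U : PowerSeries (PowerSeries (PowerSeries 𝒪)),
        PowerSeries.C (PowerSeries.C (PowerSeries.C (((p : ℕ) : 𝒪) ^ c k))) * L =
          F * G + PowerSeries.C (PowerSeries.C (PowerSeries.X - PowerSeries.C (algebraMap ℤ_[p] 𝒪 (x k)))) * U) →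
      ¬ (PowerSeries.C (PowerSeries.C (PowerSeries.X - PowerSeries.C (algebraMap ℤ_[p] 𝒪 xlim))) ∣ F) →
      ∃ (a : ℕ) (G U : PowerSeries (PowerSeries (PowerSeries 𝒪))),
        PowerSeries.C (PowerSeries.C (PowerSeries.C (((p : ℕ) : 𝒪) ^ a))) * L =
          F * G + PowerSeries.C (PowerSeries.C (PowerSeries.X - PowerSeries.C (algebraMap ℤ_[p] 𝒪 xlim))) * U

/-- **`AccumulationLemma₂U p` — the UNIFORM-constant variant** (documentary `def`, sorry-free): with a uniform member
constant `c` the nondegeneracy of the limit fibre of `F` is CONCLUDED from that of `L` (`[X − x_∞] ∤ L`), i.e. in the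
application the `Λ₂`-torsion of `X_Gr(f_E/K̃_∞)` at the `p`-new point is produced by accumulation from the nonvanishing of
`f_E`'s two-variable `p`-adic `L`-function. Stated as a `def`; not a stub. PROOF STATUS (v1.3): **PROVED** —
`accumulationLemma₂U_holds : AccumulationLemma₂U p` (§0a, sorry-free, standard axioms, NO unique-factorisation input): the
first conjunct is Theorem U₁ `not_dvd_of_uniform_members` (`[X − x_∞] ∣ F` gives `p^{v_p(x_k − x_∞)} ∣ p^c·L(x_k)`
coefficientwise while `L(x_k) ≡ L(x_∞) mod (x_k − x_∞)`, so every coefficient of `L(x_∞)` is divisible by every power of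
`p`), the second is Theorem U₂ `dvd_limit_of_uniform_members` (the solving lemma `exists_mul_eq_of_forall_exists_mod`:
`F(x_∞)·Z ≡ p^c·L(x_∞) mod p^m` is solved by `Ev_{x_k}(G_k)` for `k ≫ 0`, and solvability modulo every `p^m` implies
solvability, by content decomposition + completeness — it does not even use `[X − x_∞] ∤ L`); the older reduction
`accumulationLemma₂U_of_accumulationLemma₂` is kept. Critic A66: TRUE as typed (now kernel-confirmed); it re-imports a
UNIFORMITY of the member constant
(Büyükboduk–Lei's `s = sup s(ψ_i) < ∞` shape) which the member stub must then carry as an explicit hypothesis (u1)/(u2).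
[cite: BuyukbodukLei2020, App. A Prop. 25 (the exact, Zariski-infinite, uniform-constant sibling)] -/
def AccumulationLemma₂U (p : ℕ) [Fact p.Prime] : Prop :=
  ∀ (𝒪 : Type) [CommRing 𝒪] [IsDomain 𝒪] [IsDiscreteValuationRing 𝒪] [Algebra ℤ_[p] 𝒪],
    IsAdicComplete (IsLocalRing.maximalIdeal 𝒪) 𝒪 → Irreducible ((p : ℕ) : 𝒪) →
    ∀ (F L : PowerSeries (PowerSeries (PowerSeries 𝒪))) (x : ℕ → ℤ_[p]) (xlim : ℤ_[p]) (c : ℕ),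
      (∀ k, ‖x k‖ < 1) → ‖xlim‖ < 1 → (∀ k, x k ≠ xlim) → Filter.Tendsto x Filter.atTop (nhds xlim) →
      (∀ k, ∃ G U : PowerSeries (PowerSeries (PowerSeries 𝒪)),
        PowerSeries.C (PowerSeries.C (PowerSeries.C (((p : ℕ) : 𝒪) ^ c))) * L =
          F * G + PowerSeries.C (PowerSeries.C (PowerSeries.X - PowerSeries.C (algebraMap ℤ_[p] 𝒪 (x k)))) * U) →
      ¬ (PowerSeries.C (PowerSeries.C (PowerSeries.X - PowerSeries.C (algebraMap ℤ_[p] 𝒪 xlim))) ∣ L) →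
      ¬ (PowerSeries.C (PowerSeries.C (PowerSeries.X - PowerSeries.C (algebraMap ℤ_[p] 𝒪 xlim))) ∣ F) ∧
      ∃ (a : ℕ) (G U : PowerSeries (PowerSeries (PowerSeries 𝒪))),
        PowerSeries.C (PowerSeries.C (PowerSeries.C (((p : ℕ) : 𝒪) ^ a))) * L =
          F * G + PowerSeries.C (PowerSeries.C (PowerSeries.X - PowerSeries.C (algebraMap ℤ_[p] 𝒪 xlim))) * U


/-! ## §0a The lever (critic V95 P1): PROVED IN FULL, sorry-free (v1.3 the uniform variant, v1.4 the lemma itself)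

`AccumulationLemma₂` and `AccumulationLemma₂U` are THEOREMS below (pure commutative algebra, standard axioms); the pieces: **Theorem A** `exists_eq_C_C_pow_mul_unit_of_coeff_adic_limit` — closedness of
`π^ℕ·(units)` in `𝒪⟦T₂⟧⟦T₁⟧` under coefficientwise `π`-adic convergence that is UNIFORM in the coefficient
index (the «UFD-free half»: if the member fibres are `π^{a_k}·unit` and converge to a nonzero limit fibre,
the limit fibre is `π^b·unit`); the **evaluation calculus** `evAt` / `EvAt` at a point of the maximal ideal
(Weierstrass division by the degree-one distinguished polynomial `X − x`, Mathlib
`Polynomial.IsDistinguishedAt.algEquivQuotient`): kernel `= ([X − x])`, `ev_x ∘ C = id`, `ev_x X = x`,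
`(x − y) ∣ ev_x f − ev_y f`; and **Theorem U₁** `not_dvd_of_uniform_members` — with a UNIFORM member
constant, `[X − x_∞] ∤ L ⟹ [X − x_∞] ∤ F` (the torsion OUTPUT of the uniform variant); **v1.3: the
solving lemma** `exists_mul_eq_of_forall_exists_mod` (`A·Z ≡ B mod π^m` solvable for all `m` ⟹ `A·Z = B`
solvable in `𝒪⟦T₂⟧⟦T₁⟧`, `𝒪` a complete DVR — content decomposition + `(𝒪/π)⟦T₂⟧⟦T₁⟧` a domain +
completeness; no UFD, no compactness) and **Theorem U₂** `dvd_limit_of_uniform_members` (uniform member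
constant ⟹ the limit-fibre divisibility `F(x_∞) ∣ p^c·L(x_∞)`, lifted to `p^c·L ∈ (F, [X − x_∞])`), whence
`accumulationLemma₂U_holds : AccumulationLemma₂U p` — THE UNIFORM VARIANT IS FULLY PROVED (the reduction
`accumulationLemma₂U_of_accumulationLemma₂` is kept); **v1.4: Theorem P** `dvd_limit_of_members` — the VARYING-constant
lemma itself: content decomposition of both limit fibres (`exists_eq_C_C_pow_mul_not_dvd`) and non-zero-divisor
cancellation (`C_C_pow_dvd_of_dvd_mul`) make each member identity near `x_∞` an EXACT unit-content fibre identity, and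
the solving lemma finishes — whence `accumulationLemma₂_holds : AccumulationLemma₂ p`. NOTHING of the lever remains
unproved; the v1.2 named input `UFDInput` is deleted. -/



section Lever

variable {𝒪 : Type*} [CommRing 𝒪]

/-- coefficient `(i, j)` of a doubly nested power series: `T₁^i T₂^j`. -/
def co (i j : ℕ) (G : PowerSeries (PowerSeries 𝒪)) : 𝒪 := coeff j (coeff i G)

lemma co_C_C_mul (c : 𝒪) (i j : ℕ) (G : PowerSeries (PowerSeries 𝒪)) :
    co i j (C (C c) * G) = c * co i j G := by
  simp only [co, coeff_C_mul]

lemma eq_zero_of_co_eq_zero (G : PowerSeries (PowerSeries 𝒪)) (h : ∀ i j, co i j G = 0) : G = 0 := by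
  refine PowerSeries.ext fun i => ?_
  rw [map_zero]
  refine PowerSeries.ext fun j => ?_
  rw [map_zero]
  exact h i j

lemma co_zero_zero (G : PowerSeries (PowerSeries 𝒪)) :
    co 0 0 G = constantCoeff (constantCoeff G) := by
  simp only [co, coeff_zero_eq_constantCoeff_apply]

/-- **Theorem A (UFD-free half of the accumulation lemma).** In a local domain `𝒪` with a prime
`π` of finite multiplicity in every nonzero element: if `H_k = π^{a_k}·(unit)` in `𝒪⟦T₂⟧⟦T₁⟧` for
all `k`, the `H_k` converge to `H_∞ ≠ 0` coefficientwise `π`-adically (uniformly in the coefficient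
index), then `H_∞ = π^b·(unit)`. -/
theorem exists_eq_C_C_pow_mul_unit_of_coeff_adic_limit [IsDomain 𝒪] [IsLocalRing 𝒪]
    (π : 𝒪) (hπ : Prime π) (hfin : ∀ c : 𝒪, c ≠ 0 → ∃ n : ℕ, ¬ π ^ n ∣ c)
    (H : ℕ → PowerSeries (PowerSeries 𝒪)) (Hlim : PowerSeries (PowerSeries 𝒪)) (a : ℕ → ℕ)
    (hmem : ∀ k, ∃ u : PowerSeries (PowerSeries 𝒪), IsUnit u ∧ H k = C (C (π ^ a k)) * u)
    (hconv : ∀ m : ℕ, ∀ᶠ k in Filter.atTop, ∀ i j, π ^ m ∣ co i j (H k) - co i j Hlim)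
    (hne : Hlim ≠ 0) :
    ∃ (b : ℕ) (u : PowerSeries (PowerSeries 𝒪)), IsUnit u ∧ Hlim = C (C (π ^ b)) * u := by
  classical
  -- Step 1: a nonzero coefficient of `Hlim` and a power of `π` not dividing it.
  obtain ⟨i₀, j₀, hd⟩ : ∃ i j, co i j Hlim ≠ 0 := by
    by_contra hall
    push Not at hall
    exact hne (eq_zero_of_co_eq_zero Hlim hall)
  obtain ⟨B, hB⟩ := hfin _ hd
  -- coefficients of the members are divisible by `π ^ a k`
  have hdiv : ∀ k i j, π ^ a k ∣ co i j (H k) := by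
    intro k i j
    obtain ⟨u, -, hk⟩ := hmem k
    refine ⟨co i j u, ?_⟩
    rw [hk, co_C_C_mul]
  -- Step 2: eventually `a k < B`.
  have hlt : ∀ᶠ k in Filter.atTop, a k < B := by
    filter_upwards [hconv B] with k hk
    by_contra hge
    push Not at hge
    apply hB
    have h1 : π ^ B ∣ co i₀ j₀ (H k) := (pow_dvd_pow π hge).trans (hdiv k i₀ j₀)
    have h2 : π ^ B ∣ co i₀ j₀ (H k) - co i₀ j₀ Hlim := hk i₀ j₀
    have := dvd_sub h1 h2
    simpa using this
  -- Step 3: pick one good `k`.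
  obtain ⟨k, hkB, hk⟩ := (hlt.and (hconv B)).exists
  obtain ⟨uk, huk, hHk⟩ := hmem k
  set b := a k with hb
  -- every coefficient of `Hlim` is divisible by `π ^ b`
  have hcoef : ∀ i j, π ^ b ∣ co i j Hlim := by
    intro i j
    have h1 : π ^ b ∣ co i j (H k) := hdiv k i j
    have h2 : π ^ b ∣ co i j (H k) - co i j Hlim := (pow_dvd_pow π hkB.le).trans (hk i j)
    have := dvd_sub h1 h2
    simpa using this
  choose q hq using hcoef
  -- the (0,0) coefficient of `Hlim` is `π ^ b` times a unit
  have hunit00 : IsUnit (q 0 0) := by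
    -- `co 0 0 (H k) = π^b * e` with `e` a unit
    have hek : IsUnit (co 0 0 uk) := by
      rw [co_zero_zero]
      exact (huk.map (constantCoeff : PowerSeries (PowerSeries 𝒪) →+* PowerSeries 𝒪)).map
        (constantCoeff : PowerSeries 𝒪 →+* 𝒪)
    have hH00 : co 0 0 (H k) = π ^ b * co 0 0 uk := by rw [hHk, co_C_C_mul]
    -- `π ^ B ∣ co 0 0 (H k) - co 0 0 Hlim`, `B ≥ b + 1`
    obtain ⟨t, ht⟩ : π ^ (b + 1) ∣ co 0 0 (H k) - co 0 0 Hlim :=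
      (pow_dvd_pow π (Nat.succ_le_of_lt hkB)).trans (hk 0 0)
    -- so `π^b * q 0 0 = π^b * (co 0 0 uk - π * t)`
    have hπb : π ^ b ≠ 0 := pow_ne_zero _ hπ.ne_zero
    have hq00 : q 0 0 = co 0 0 uk - π * t := by
      apply mul_left_cancel₀ hπb
      rw [← hq 0 0, mul_sub, ← hH00, ← sub_sub_cancel (co 0 0 (H k)) (co 0 0 Hlim), ht]
      ring
    rw [hq00]
    -- unit minus an element of the maximal ideal is a unit
    have hπmem : π * t ∈ IsLocalRing.maximalIdeal 𝒪 :=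
      Ideal.mul_mem_right _ _ ((IsLocalRing.mem_maximalIdeal _).mpr hπ.not_unit)
    by_contra hnu
    have hmem' : co 0 0 uk - π * t ∈ IsLocalRing.maximalIdeal 𝒪 :=
      (IsLocalRing.mem_maximalIdeal _).mpr hnu
    have : co 0 0 uk ∈ IsLocalRing.maximalIdeal 𝒪 := by
      have := Ideal.add_mem _ hmem' hπmem
      simpa using this
    exact (IsLocalRing.mem_maximalIdeal _).mp this hek
  -- Step 4: assemble the unit
  refine ⟨b, PowerSeries.mk fun i => PowerSeries.mk fun j => q i j, ?_, ?_⟩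
  · rw [isUnit_iff_constantCoeff, isUnit_iff_constantCoeff]
    have : constantCoeff (constantCoeff (PowerSeries.mk fun i => PowerSeries.mk fun j => q i j)) =
        q 0 0 := by
      rw [← coeff_zero_eq_constantCoeff_apply]
      rw [show constantCoeff (PowerSeries.mk fun i => PowerSeries.mk fun j => q i j) =
          coeff 0 (PowerSeries.mk fun i => PowerSeries.mk fun j => q i j) from
        (coeff_zero_eq_constantCoeff_apply _).symm]
      simp only [coeff_mk]
    rw [this]
    exact hunit00
  · refine PowerSeries.ext fun i => ?_
    rw [show coeff i (C (C (π ^ b)) * PowerSeries.mk fun i => PowerSeries.mk fun j => q i j) =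
        C (π ^ b) * coeff i (PowerSeries.mk fun i => PowerSeries.mk fun j => q i j) from
      coeff_C_mul _ _ _]
    refine PowerSeries.ext fun j => ?_
    rw [coeff_C_mul]
    simp only [coeff_mk]
    exact hq i j

/-- The finiteness hypothesis holds in a discrete valuation ring for an irreducible `p`. -/
theorem finite_pow_dvd_of_dvr [IsDomain 𝒪] [IsDiscreteValuationRing 𝒪] (π : 𝒪) (hπ : Irreducible π)
    (c : 𝒪) (hc : c ≠ 0) : ∃ n : ℕ, ¬ π ^ n ∣ c := by
  have hprime : Prime π := hπ.prime
  obtain ⟨n, hn⟩ := FiniteMultiplicity.of_prime_left hprime hc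
  exact ⟨n + 1, hn⟩


/-! ### Evaluation at a point of the maximal ideal (Weierstrass division by `X − x`) -/

section Eval

variable {𝒪 : Type*} [CommRing 𝒪] [IsLocalRing 𝒪] [IsAdicComplete (IsLocalRing.maximalIdeal 𝒪) 𝒪]

omit [IsAdicComplete (IsLocalRing.maximalIdeal 𝒪) 𝒪] in
lemma isDistinguishedAt_X_sub_C {x : 𝒪} (hx : x ∈ IsLocalRing.maximalIdeal 𝒪) :
    (Polynomial.X - Polynomial.C x).IsDistinguishedAt (IsLocalRing.maximalIdeal 𝒪) where
  mem := by
    intro n hn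
    rw [Polynomial.natDegree_X_sub_C] at hn
    have hn0 : n = 0 := by omega
    subst hn0
    simp only [Polynomial.coeff_sub, Polynomial.coeff_X_zero, Polynomial.coeff_C_zero, zero_sub]
    exact neg_mem hx
  monic := Polynomial.monic_X_sub_C x

omit [IsLocalRing 𝒪] [IsAdicComplete (IsLocalRing.maximalIdeal 𝒪) 𝒪] in
lemma coe_X_sub_C (x : 𝒪) :
    ((Polynomial.X - Polynomial.C x : Polynomial 𝒪) : PowerSeries 𝒪) =
      PowerSeries.X - PowerSeries.C x := by
  rw [← Polynomial.coeToPowerSeries.ringHom_apply, map_sub, Polynomial.coeToPowerSeries.ringHom_apply,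
    Polynomial.coeToPowerSeries.ringHom_apply, Polynomial.coe_X, Polynomial.coe_C]

/-- `ev_x : 𝒪⟦X⟧ →ₐ[𝒪] 𝒪`, evaluation at `x ∈ 𝔪` (the remainder of Weierstrass division by `X − x`). -/
def evAt (x : 𝒪) (hx : x ∈ IsLocalRing.maximalIdeal 𝒪) : PowerSeries 𝒪 →ₐ[𝒪] 𝒪 :=
  ((Polynomial.quotientSpanXSubCAlgEquiv x).toAlgHom.comp
    (isDistinguishedAt_X_sub_C hx).algEquivQuotient.symm.toAlgHom).comp
    (Ideal.Quotient.mkₐ 𝒪 (Ideal.span {((Polynomial.X - Polynomial.C x : Polynomial 𝒪) : PowerSeries 𝒪)}))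

lemma evAt_C (x : 𝒪) (hx : x ∈ IsLocalRing.maximalIdeal 𝒪) (a : 𝒪) : evAt x hx (PowerSeries.C a) = a := by
  have := (evAt x hx).commutes a
  rwa [← PowerSeries.C_eq_algebraMap] at this

lemma evAt_eq_zero_iff (x : 𝒪) (hx : x ∈ IsLocalRing.maximalIdeal 𝒪) (f : PowerSeries 𝒪) :
    evAt x hx f = 0 ↔ (PowerSeries.X - PowerSeries.C x) ∣ f := by
  change (Polynomial.quotientSpanXSubCAlgEquiv x)
      ((isDistinguishedAt_X_sub_C hx).algEquivQuotient.symm (Ideal.Quotient.mk _ f)) = 0 ↔ _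
  rw [EmbeddingLike.map_eq_zero_iff, EmbeddingLike.map_eq_zero_iff, Ideal.Quotient.eq_zero_iff_mem,
    Ideal.mem_span_singleton, coe_X_sub_C]

lemma X_sub_C_dvd_sub_C_evAt (x : 𝒪) (hx : x ∈ IsLocalRing.maximalIdeal 𝒪) (f : PowerSeries 𝒪) :
    (PowerSeries.X - PowerSeries.C x) ∣ f - PowerSeries.C (evAt x hx f) := by
  rw [← evAt_eq_zero_iff x hx, map_sub, evAt_C, sub_self]

lemma evAt_X (x : 𝒪) (hx : x ∈ IsLocalRing.maximalIdeal 𝒪) : evAt x hx PowerSeries.X = x := by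
  have h : evAt x hx (PowerSeries.X - PowerSeries.C x) = 0 := (evAt_eq_zero_iff x hx _).mpr dvd_rfl
  rw [map_sub, evAt_C, sub_eq_zero] at h
  exact h

/-- two evaluations differ by a multiple of the difference of the points -/
lemma sub_dvd_evAt_sub_evAt (x y : 𝒪) (hx : x ∈ IsLocalRing.maximalIdeal 𝒪)
    (hy : y ∈ IsLocalRing.maximalIdeal 𝒪) (f : PowerSeries 𝒪) :
    (x - y) ∣ evAt x hx f - evAt y hy f := by
  obtain ⟨q, hq⟩ := X_sub_C_dvd_sub_C_evAt y hy f
  have : f = PowerSeries.C (evAt y hy f) + (PowerSeries.X - PowerSeries.C y) * q := by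
    rw [← hq]; ring
  have h2 : evAt x hx f = evAt y hy f + (x - y) * evAt x hx q := by
    conv_lhs => rw [this]
    rw [map_add, evAt_C, map_mul, map_sub, evAt_X, evAt_C]
  exact ⟨evAt x hx q, by rw [h2]; ring⟩

/-- coefficientwise evaluation `𝒪⟦X⟧⟦T₂⟧⟦T₁⟧ → 𝒪⟦T₂⟧⟦T₁⟧` -/
def EvAt (x : 𝒪) (hx : x ∈ IsLocalRing.maximalIdeal 𝒪) :
    PowerSeries (PowerSeries (PowerSeries 𝒪)) →+* PowerSeries (PowerSeries 𝒪) :=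
  PowerSeries.map (PowerSeries.map (evAt x hx).toRingHom)

lemma EvAt_C_C (x : 𝒪) (hx : x ∈ IsLocalRing.maximalIdeal 𝒪) (c : PowerSeries 𝒪) :
    EvAt x hx (PowerSeries.C (PowerSeries.C c)) = PowerSeries.C (PowerSeries.C (evAt x hx c)) := by
  simp only [EvAt, PowerSeries.map_C]
  rfl

lemma co_EvAt (x : 𝒪) (hx : x ∈ IsLocalRing.maximalIdeal 𝒪) (i j : ℕ)
    (H : PowerSeries (PowerSeries (PowerSeries 𝒪))) :
    co i j (EvAt x hx H) = evAt x hx (coeff j (coeff i H)) := by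
  simp only [co, EvAt, PowerSeries.coeff_map]
  rfl

lemma C_C_dvd_of_EvAt_eq_zero (x : 𝒪) (hx : x ∈ IsLocalRing.maximalIdeal 𝒪)
    (H : PowerSeries (PowerSeries (PowerSeries 𝒪))) (h : EvAt x hx H = 0) :
    PowerSeries.C (PowerSeries.C (PowerSeries.X - PowerSeries.C x)) ∣ H := by
  have hc : ∀ i j, (PowerSeries.X - PowerSeries.C x) ∣ coeff j (coeff i H) := by
    intro i j
    rw [← evAt_eq_zero_iff x hx, ← co_EvAt, h]
    simp [co]
  choose q hq using hc
  refine ⟨PowerSeries.mk fun i => PowerSeries.mk fun j => q i j, ?_⟩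
  refine PowerSeries.ext fun i => ?_
  rw [PowerSeries.coeff_C_mul]
  refine PowerSeries.ext fun j => ?_
  rw [PowerSeries.coeff_C_mul]
  simp only [PowerSeries.coeff_mk]
  exact hq i j

end Eval

/-! ### Theorem U₁: uniform member constants + nondegenerate analytic limit fibre ⟹ nondegenerate
algebraic limit fibre (the torsion OUTPUT of `AccumulationLemma₂U`), PROVED. -/

section Uniform

open Filter

/-- `p`-adic convergence in `ℤ_[p]` gives divisibility of differences by high powers of `p`. -/
lemma eventually_pow_dvd_sub {p : ℕ} [Fact p.Prime] (x : ℕ → ℤ_[p]) (xlim : ℤ_[p])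
    (hx : Tendsto x atTop (nhds xlim)) (m : ℕ) :
    ∀ᶠ k in atTop, (p : ℤ_[p]) ^ m ∣ x k - xlim := by
  have hp0 : (0 : ℝ) < (p : ℝ) := by exact_mod_cast (Fact.out : p.Prime).pos
  have hε : (0 : ℝ) < (p : ℝ) ^ (-(m : ℤ)) := zpow_pos hp0 _
  have := (Metric.tendsto_atTop.mp hx) _ hε
  obtain ⟨N, hN⟩ := this
  filter_upwards [eventually_ge_atTop N] with k hk
  have h1 : ‖x k - xlim‖ ≤ (p : ℝ) ^ (-(m : ℤ)) := by
    have := hN k hk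
    rw [dist_eq_norm] at this
    exact this.le
  rw [PadicInt.norm_le_pow_iff_mem_span_pow] at h1
  exact Ideal.mem_span_singleton.mp h1

theorem not_dvd_of_uniform_members {p : ℕ} [Fact p.Prime]
    (𝒪 : Type*) [CommRing 𝒪] [IsDomain 𝒪] [IsDiscreteValuationRing 𝒪] [Algebra ℤ_[p] 𝒪]
    [IsAdicComplete (IsLocalRing.maximalIdeal 𝒪) 𝒪] (hp : Irreducible ((p : ℕ) : 𝒪))
    (F L : PowerSeries (PowerSeries (PowerSeries 𝒪))) (x : ℕ → ℤ_[p]) (xlim : ℤ_[p]) (c : ℕ)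
    (hxk : ∀ k, ‖x k‖ < 1) (hxlim : ‖xlim‖ < 1)
    (hconv : Tendsto x atTop (nhds xlim))
    (hmem : ∀ k, ∃ G U : PowerSeries (PowerSeries (PowerSeries 𝒪)),
      PowerSeries.C (PowerSeries.C (PowerSeries.C (((p : ℕ) : 𝒪) ^ c))) * L =
        F * G + PowerSeries.C (PowerSeries.C (PowerSeries.X - PowerSeries.C (algebraMap ℤ_[p] 𝒪 (x k)))) * U)
    (hL : ¬ (PowerSeries.C (PowerSeries.C (PowerSeries.X - PowerSeries.C (algebraMap ℤ_[p] 𝒪 xlim))) ∣ L)) :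
    ¬ (PowerSeries.C (PowerSeries.C (PowerSeries.X - PowerSeries.C (algebraMap ℤ_[p] 𝒪 xlim))) ∣ F) := by
  classical
  -- the points lie in the maximal ideal
  have hpmem : ((p : ℕ) : 𝒪) ∈ IsLocalRing.maximalIdeal 𝒪 :=
    (IsLocalRing.mem_maximalIdeal _).mpr hp.not_isUnit
  have hpt : ∀ z : ℤ_[p], ‖z‖ < 1 → algebraMap ℤ_[p] 𝒪 z ∈ IsLocalRing.maximalIdeal 𝒪 := by
    intro z hz
    obtain ⟨y, hy⟩ := (PadicInt.norm_lt_one_iff_dvd z).mp hz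
    rw [hy, map_mul, map_natCast]
    exact Ideal.mul_mem_right _ _ hpmem
  set xs : ℕ → 𝒪 := fun k => algebraMap ℤ_[p] 𝒪 (x k) with hxs
  set xsl : 𝒪 := algebraMap ℤ_[p] 𝒪 xlim with hxsl
  have hxs_mem : ∀ k, xs k ∈ IsLocalRing.maximalIdeal 𝒪 := fun k => hpt _ (hxk k)
  have hxsl_mem : xsl ∈ IsLocalRing.maximalIdeal 𝒪 := hpt _ hxlim
  -- divisibility of `xs k - xsl` by powers of `p`
  have hdiff : ∀ m : ℕ, ∀ᶠ k in atTop, ((p : ℕ) : 𝒪) ^ m ∣ xs k - xsl := by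
    intro m
    filter_upwards [eventually_pow_dvd_sub x xlim hconv m] with k hk
    have := map_dvd (algebraMap ℤ_[p] 𝒪) hk
    simpa [map_pow, map_natCast, map_sub] using this
  intro hF
  obtain ⟨F₁, hF₁⟩ := hF
  have hp0 : ((p : ℕ) : 𝒪) ≠ 0 := hp.ne_zero
  -- Claim: every coefficient of `Ev_∞ L` is divisible by every power of `p`.
  have hall : ∀ i j (n : ℕ), ((p : ℕ) : 𝒪) ^ n ∣ co i j (EvAt xsl hxsl_mem L) := by
    intro i j n
    obtain ⟨k, hk⟩ := (hdiff (c + n)).exists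
    obtain ⟨G, U, hGU⟩ := hmem k
    -- apply `Ev_k` to the member identity
    have e1 : EvAt (xs k) (hxs_mem k) (PowerSeries.C (PowerSeries.C (PowerSeries.C (((p : ℕ) : 𝒪) ^ c)))) =
        PowerSeries.C (PowerSeries.C (((p : ℕ) : 𝒪) ^ c)) := by
      rw [EvAt_C_C, evAt_C]
    have e2 : EvAt (xs k) (hxs_mem k) (PowerSeries.C (PowerSeries.C (PowerSeries.X - PowerSeries.C xsl))) =
        PowerSeries.C (PowerSeries.C (xs k - xsl)) := by
      rw [EvAt_C_C, map_sub, evAt_X, evAt_C]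
    have e3 : EvAt (xs k) (hxs_mem k)
        (PowerSeries.C (PowerSeries.C (PowerSeries.X - PowerSeries.C (algebraMap ℤ_[p] 𝒪 (x k))))) = 0 := by
      rw [EvAt_C_C, map_sub, evAt_X, evAt_C,
        show xs k - algebraMap ℤ_[p] 𝒪 (x k) = 0 from sub_self _, map_zero, map_zero]
    rw [hF₁] at hGU
    have hEv := congrArg (EvAt (xs k) (hxs_mem k)) hGU
    simp only [map_mul, map_add, e1, e2, e3, zero_mul, add_zero] at hEv
    -- coefficient `(i,j)`: `p^c * co (Ev_k L) = (xs k - xsl) * co (...)`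
    have hco : ((p : ℕ) : 𝒪) ^ c * co i j (EvAt (xs k) (hxs_mem k) L) =
        (xs k - xsl) * co i j (EvAt (xs k) (hxs_mem k) F₁ * EvAt (xs k) (hxs_mem k) G) := by
      have := congrArg (co i j) hEv
      rwa [co_C_C_mul, mul_assoc, co_C_C_mul] at this
    -- so `p^(c+n) ∣ p^c * co i j (Ev_k L)`
    have h1 : ((p : ℕ) : 𝒪) ^ (c + n) ∣ ((p : ℕ) : 𝒪) ^ c * co i j (EvAt (xs k) (hxs_mem k) L) := by
      rw [hco]; exact dvd_mul_of_dvd_left hk _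
    have h2 : ((p : ℕ) : 𝒪) ^ n ∣ co i j (EvAt (xs k) (hxs_mem k) L) := by
      rw [pow_add] at h1
      exact (mul_dvd_mul_iff_left (pow_ne_zero _ hp0)).mp h1
    -- compare with the limit fibre
    have h3 : ((p : ℕ) : 𝒪) ^ n ∣
        co i j (EvAt (xs k) (hxs_mem k) L) - co i j (EvAt xsl hxsl_mem L) := by
      rw [co_EvAt, co_EvAt]
      exact ((pow_dvd_pow _ (Nat.le_add_left n c)).trans hk).trans
        (sub_dvd_evAt_sub_evAt _ _ (hxs_mem k) hxsl_mem _)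
    have := dvd_sub h2 h3
    simpa using this
  -- hence `Ev_∞ L = 0`
  have hzero : EvAt xsl hxsl_mem L = 0 := by
    apply eq_zero_of_co_eq_zero
    intro i j
    by_contra hne
    obtain ⟨n, hn⟩ := finite_pow_dvd_of_dvr ((p : ℕ) : 𝒪) hp _ hne
    exact hn (hall i j n)
  exact hL (C_C_dvd_of_EvAt_eq_zero xsl hxsl_mem L hzero)

end Uniform

/-! ### Solving `A·Z = B` from solvability modulo every `π^m` (no UFD, no compactness) -/

section Solve

variable {𝒪 : Type*} [CommRing 𝒪]

lemma C_C_dvd_iff_forall_co_dvd (a : 𝒪) (H : PowerSeries (PowerSeries 𝒪)) :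
    PowerSeries.C (PowerSeries.C a) ∣ H ↔ ∀ i j, a ∣ co i j H := by
  constructor
  · rintro ⟨W, rfl⟩ i j
    exact ⟨co i j W, by rw [co_C_C_mul]⟩
  · intro h
    choose q hq using h
    refine ⟨PowerSeries.mk fun i => PowerSeries.mk fun j => q i j, ?_⟩
    refine PowerSeries.ext fun i => ?_
    rw [PowerSeries.coeff_C_mul]
    refine PowerSeries.ext fun j => ?_
    rw [PowerSeries.coeff_C_mul]
    simp only [PowerSeries.coeff_mk]
    exact hq i j

lemma C_C_pow (a : 𝒪) (m : ℕ) :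
    (PowerSeries.C (PowerSeries.C (a ^ m)) : PowerSeries (PowerSeries 𝒪)) =
      PowerSeries.C (PowerSeries.C a) ^ m := by
  rw [map_pow, map_pow]

/-- `C (C π)` is prime in `𝒪⟦T₂⟧⟦T₁⟧` when `π` is prime in `𝒪`: the form we need. -/
lemma C_C_dvd_of_dvd_mul [IsDomain 𝒪] (π : 𝒪) (hπ : Prime π) (F W : PowerSeries (PowerSeries 𝒪))
    (h : PowerSeries.C (PowerSeries.C π) ∣ F * W) (hF : ¬ PowerSeries.C (PowerSeries.C π) ∣ F) :
    PowerSeries.C (PowerSeries.C π) ∣ W := by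
  classical
  haveI : (Ideal.span ({π} : Set 𝒪)).IsPrime := (Ideal.span_singleton_prime hπ.ne_zero).mpr hπ
  haveI : IsDomain (𝒪 ⧸ Ideal.span ({π} : Set 𝒪)) :=
    (Ideal.Quotient.isDomain_iff_prime _).mpr inferInstance
  let φ : PowerSeries (PowerSeries 𝒪) →+* PowerSeries (PowerSeries (𝒪 ⧸ Ideal.span ({π} : Set 𝒪))) :=
    PowerSeries.map (PowerSeries.map (Ideal.Quotient.mk (Ideal.span ({π} : Set 𝒪))))
  have hker : ∀ H : PowerSeries (PowerSeries 𝒪), φ H = 0 ↔ PowerSeries.C (PowerSeries.C π) ∣ H := by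
    intro H
    rw [C_C_dvd_iff_forall_co_dvd]
    constructor
    · intro h0 i j
      have := congrArg (fun G => PowerSeries.coeff j (PowerSeries.coeff i G)) h0
      simp only [φ, PowerSeries.coeff_map, map_zero, Ideal.Quotient.eq_zero_iff_mem,
        Ideal.mem_span_singleton] at this
      exact this
    · intro h
      refine PowerSeries.ext fun i => PowerSeries.ext fun j => ?_
      simp only [φ, PowerSeries.coeff_map, map_zero, Ideal.Quotient.eq_zero_iff_mem,
        Ideal.mem_span_singleton]
      exact h i j
  have hmul : φ F * φ W = 0 := by rw [← map_mul, (hker _).mpr h]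
  rcases mul_eq_zero.mp hmul with h1 | h2
  · exact absurd ((hker F).mp h1) hF
  · exact (hker W).mp h2

lemma C_C_pow_dvd_of_dvd_mul [IsDomain 𝒪] (π : 𝒪) (hπ : Prime π) (F : PowerSeries (PowerSeries 𝒪))
    (hF : ¬ PowerSeries.C (PowerSeries.C π) ∣ F) :
    ∀ (m : ℕ) (W : PowerSeries (PowerSeries 𝒪)),
      PowerSeries.C (PowerSeries.C (π ^ m)) ∣ F * W → PowerSeries.C (PowerSeries.C (π ^ m)) ∣ W := by
  intro m
  induction m with
  | zero => intro W _; simp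
  | succ m ih =>
    intro W h
    have h1 : PowerSeries.C (PowerSeries.C π) ∣ F * W := by
      refine (dvd_trans ?_ h)
      rw [C_C_pow]
      exact dvd_pow_self _ (Nat.succ_ne_zero m)
    obtain ⟨W₁, rfl⟩ := C_C_dvd_of_dvd_mul π hπ F W h1 hF
    obtain ⟨V, hV⟩ := h
    have hne : (PowerSeries.C (PowerSeries.C π) : PowerSeries (PowerSeries 𝒪)) ≠ 0 := by
      intro h0
      have := congrArg (fun G => co 0 0 G) h0
      simp only [co, PowerSeries.coeff_zero_eq_constantCoeff_apply, PowerSeries.constantCoeff_C,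
        map_zero] at this
      exact hπ.ne_zero this
    have h2 : F * W₁ = PowerSeries.C (PowerSeries.C (π ^ m)) * V := by
      apply mul_left_cancel₀ hne
      rw [← mul_assoc, mul_comm (PowerSeries.C (PowerSeries.C π)) F, mul_assoc, hV, pow_succ,
        map_mul, map_mul]
      ring
    have h3 := ih W₁ ⟨V, h2⟩
    rw [pow_succ, map_mul, map_mul, mul_comm]
    exact mul_dvd_mul_left _ h3

/-- **Solving lemma.** `𝒪` a complete DVR with uniformiser `π`: if `A·Z ≡ B (mod π^m)` is solvable in
`𝒪⟦T₂⟧⟦T₁⟧` for every `m`, then `A·Z = B` is solvable. (Content decomposition `A = π^b·A'`, `A'` a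
non-zero-divisor modulo every `π^m`, uniqueness makes the approximate solutions Cauchy; completeness.) -/
theorem exists_mul_eq_of_forall_exists_mod [IsDomain 𝒪] [IsDiscreteValuationRing 𝒪]
    [IsAdicComplete (IsLocalRing.maximalIdeal 𝒪) 𝒪] (π : 𝒪) (hπ : Irreducible π)
    (A B : PowerSeries (PowerSeries 𝒪))
    (hsol : ∀ m : ℕ, ∃ Z : PowerSeries (PowerSeries 𝒪),
      PowerSeries.C (PowerSeries.C (π ^ m)) ∣ A * Z - B) :
    ∃ Z : PowerSeries (PowerSeries 𝒪), A * Z = B := by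
  classical
  have hprime : Prime π := hπ.prime
  have hmax : IsLocalRing.maximalIdeal 𝒪 = Ideal.span {π} :=
    (IsDiscreteValuationRing.irreducible_iff_uniformizer π).mp hπ
  -- coefficients divisible by every power of π vanish
  have hzero : ∀ c : 𝒪, (∀ n : ℕ, π ^ n ∣ c) → c = 0 := by
    intro c hc
    by_contra hne
    obtain ⟨n, hn⟩ := finite_pow_dvd_of_dvr π hπ c hne
    exact hn (hc n)
  by_cases hA : A = 0
  · subst hA
    refine ⟨0, ?_⟩
    have hB : ∀ i j (n : ℕ), π ^ n ∣ co i j B := by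
      intro i j n
      obtain ⟨Z, hZ⟩ := hsol n
      rw [zero_mul, zero_sub, dvd_neg] at hZ
      exact (C_C_dvd_iff_forall_co_dvd _ _).mp hZ i j
    rw [mul_zero]
    exact (eq_zero_of_co_eq_zero B fun i j => hzero _ (hB i j)).symm
  -- content decomposition of A
  obtain ⟨i₀, j₀, hd⟩ : ∃ i j, co i j A ≠ 0 := by
    by_contra hall
    push Not at hall
    exact hA (eq_zero_of_co_eq_zero A hall)
  have hex : ∃ n : ℕ, ∃ i j, ¬ π ^ (n + 1) ∣ co i j A := by
    obtain ⟨N, hN⟩ := finite_pow_dvd_of_dvr π hπ _ hd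
    rcases N with _ | n
    · exact absurd (by simp) hN
    · exact ⟨n, i₀, j₀, hN⟩
  let b := Nat.find hex
  obtain ⟨i₁, j₁, hb⟩ : ∃ i j, ¬ π ^ (b + 1) ∣ co i j A := Nat.find_spec hex
  have hball : ∀ i j, π ^ b ∣ co i j A := by
    intro i j
    rcases Nat.eq_zero_or_pos b with h0 | hpos
    · rw [h0, pow_zero]; exact one_dvd _
    · have hmin := Nat.find_min hex (m := b - 1) (by omega)
      push Not at hmin
      have := hmin i j
      rwa [Nat.sub_add_cancel hpos] at this
  obtain ⟨A', hA'⟩ := (C_C_dvd_iff_forall_co_dvd (π ^ b) A).mpr hball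
  have hA'nd : ¬ PowerSeries.C (PowerSeries.C π) ∣ A' := by
    intro h
    apply hb
    have h' := (C_C_dvd_iff_forall_co_dvd π A').mp h i₁ j₁
    rw [hA', co_C_C_mul, pow_succ]
    exact mul_dvd_mul_left _ h'
  have hCne : ∀ m : ℕ, (PowerSeries.C (PowerSeries.C (π ^ m)) : PowerSeries (PowerSeries 𝒪)) ≠ 0 := by
    intro m h0
    have := congrArg (fun G => co 0 0 G) h0
    simp only [co, PowerSeries.coeff_zero_eq_constantCoeff_apply, PowerSeries.constantCoeff_C,
      map_zero] at this
    exact pow_ne_zero _ hπ.ne_zero this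
  -- B is divisible by π^b
  obtain ⟨B', hB'⟩ : PowerSeries.C (PowerSeries.C (π ^ b)) ∣ B := by
    obtain ⟨Z, hZ⟩ := hsol b
    have h1 : PowerSeries.C (PowerSeries.C (π ^ b)) ∣ A * Z := by
      rw [hA', mul_assoc]; exact dvd_mul_right _ _
    have := dvd_sub h1 hZ
    simpa using this
  -- reduced approximate solutions
  have hsol' : ∀ m : ℕ, ∃ Z : PowerSeries (PowerSeries 𝒪),
      PowerSeries.C (PowerSeries.C (π ^ m)) ∣ A' * Z - B' := by
    intro m
    obtain ⟨Z, hZ⟩ := hsol (b + m)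
    refine ⟨Z, ?_⟩
    rw [hA', hB', mul_assoc, ← mul_sub, pow_add, map_mul, map_mul] at hZ
    exact (mul_dvd_mul_iff_left (hCne b)).mp hZ
  choose Z hZ using hsol'
  -- Cauchy property
  have hcau : ∀ m n, m ≤ n → PowerSeries.C (PowerSeries.C (π ^ m)) ∣ Z m - Z n := by
    intro m n hmn
    apply C_C_pow_dvd_of_dvd_mul π hprime A' hA'nd m
    have h1 : PowerSeries.C (PowerSeries.C (π ^ m)) ∣ A' * Z n - B' :=
      (dvd_trans (by rw [C_C_pow, C_C_pow]; exact pow_dvd_pow _ hmn) (hZ n))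
    have := dvd_sub (hZ m) h1
    rw [mul_sub]
    simpa using this
  -- coefficientwise limits
  have hlim : ∀ i j, ∃ z : 𝒪, ∀ n, π ^ n ∣ co i j (Z n) - z := by
    intro i j
    have hf : ∀ {m n}, m ≤ n → co i j (Z m) ≡ co i j (Z n)
        [SMOD (IsLocalRing.maximalIdeal 𝒪 ^ m • ⊤ : Submodule 𝒪 𝒪)] := by
      intro m n hmn
      rw [SModEq.sub_mem, hmax, Ideal.span_singleton_pow, smul_eq_mul, Ideal.mul_top,
        Ideal.mem_span_singleton]
      have := (C_C_dvd_iff_forall_co_dvd _ _).mp (hcau m n hmn) i j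
      simpa [co, map_sub] using this
    obtain ⟨z, hz⟩ := IsPrecomplete.prec' (fun m => co i j (Z m)) hf
    refine ⟨z, fun n => ?_⟩
    have := hz n
    rwa [SModEq.sub_mem, hmax, Ideal.span_singleton_pow, smul_eq_mul, Ideal.mul_top,
      Ideal.mem_span_singleton] at this
  choose z hz using hlim
  set Zinf : PowerSeries (PowerSeries 𝒪) := PowerSeries.mk fun i => PowerSeries.mk fun j => z i j
  have hco : ∀ i j, co i j Zinf = z i j := by
    intro i j; simp only [Zinf, co, PowerSeries.coeff_mk]
  have happrox : ∀ n, PowerSeries.C (PowerSeries.C (π ^ n)) ∣ Z n - Zinf := by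
    intro n
    rw [C_C_dvd_iff_forall_co_dvd]
    intro i j
    have := hz i j n
    simpa [co, map_sub, hco, Zinf] using this
  have hfinal : ∀ n, PowerSeries.C (PowerSeries.C (π ^ n)) ∣ A' * Zinf - B' := by
    intro n
    have h1 : PowerSeries.C (PowerSeries.C (π ^ n)) ∣ A' * (Z n - Zinf) :=
      dvd_mul_of_dvd_right (happrox n) _
    have := dvd_sub (hZ n) h1
    rw [mul_sub] at this
    simpa using this
  have hEq : A' * Zinf - B' = 0 := by
    apply eq_zero_of_co_eq_zero
    intro i j
    apply hzero
    intro n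
    exact (C_C_dvd_iff_forall_co_dvd _ _).mp (hfinal n) i j
  refine ⟨Zinf, ?_⟩
  rw [hA', hB', mul_assoc, sub_eq_zero.mp hEq]

end Solve

/-! ### Theorem U₂: with a UNIFORM member constant the limit-fibre divisibility holds outright
(no UFD, no nondegeneracy) — hence `AccumulationLemma₂U` is a THEOREM. -/

section Uniform2

open Filter

/-- the constant lift `𝒪⟦T₂⟧⟦T₁⟧ → 𝒪⟦X⟧⟦T₂⟧⟦T₁⟧` is a section of every `EvAt`. -/
lemma EvAt_lift {𝒪 : Type*} [CommRing 𝒪] [IsLocalRing 𝒪]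
    [IsAdicComplete (IsLocalRing.maximalIdeal 𝒪) 𝒪] (x : 𝒪) (hx : x ∈ IsLocalRing.maximalIdeal 𝒪)
    (Z : PowerSeries (PowerSeries 𝒪)) :
    EvAt x hx (PowerSeries.map (PowerSeries.map (PowerSeries.C (R := 𝒪))) Z) = Z := by
  apply eq_of_sub_eq_zero
  apply eq_zero_of_co_eq_zero
  intro i j
  rw [co, map_sub, map_sub, ← co, co_EvAt, PowerSeries.coeff_map, PowerSeries.coeff_map, evAt_C]
  simp

theorem dvd_limit_of_uniform_members {p : ℕ} [Fact p.Prime]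
    (𝒪 : Type*) [CommRing 𝒪] [IsDomain 𝒪] [IsDiscreteValuationRing 𝒪] [Algebra ℤ_[p] 𝒪]
    [IsAdicComplete (IsLocalRing.maximalIdeal 𝒪) 𝒪] (hp : Irreducible ((p : ℕ) : 𝒪))
    (F L : PowerSeries (PowerSeries (PowerSeries 𝒪))) (x : ℕ → ℤ_[p]) (xlim : ℤ_[p]) (c : ℕ)
    (hxk : ∀ k, ‖x k‖ < 1) (hxlim : ‖xlim‖ < 1)
    (hconv : Tendsto x atTop (nhds xlim))
    (hmem : ∀ k, ∃ G U : PowerSeries (PowerSeries (PowerSeries 𝒪)),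
      PowerSeries.C (PowerSeries.C (PowerSeries.C (((p : ℕ) : 𝒪) ^ c))) * L =
        F * G + PowerSeries.C (PowerSeries.C (PowerSeries.X - PowerSeries.C (algebraMap ℤ_[p] 𝒪 (x k)))) * U) :
    ∃ (G U : PowerSeries (PowerSeries (PowerSeries 𝒪))),
      PowerSeries.C (PowerSeries.C (PowerSeries.C (((p : ℕ) : 𝒪) ^ c))) * L =
        F * G + PowerSeries.C (PowerSeries.C (PowerSeries.X - PowerSeries.C (algebraMap ℤ_[p] 𝒪 xlim))) * U := by
  classical
  have hpmem : ((p : ℕ) : 𝒪) ∈ IsLocalRing.maximalIdeal 𝒪 :=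
    (IsLocalRing.mem_maximalIdeal _).mpr hp.not_isUnit
  have hpt : ∀ z : ℤ_[p], ‖z‖ < 1 → algebraMap ℤ_[p] 𝒪 z ∈ IsLocalRing.maximalIdeal 𝒪 := by
    intro z hz
    obtain ⟨y, hy⟩ := (PadicInt.norm_lt_one_iff_dvd z).mp hz
    rw [hy, map_mul, map_natCast]
    exact Ideal.mul_mem_right _ _ hpmem
  set xs : ℕ → 𝒪 := fun k => algebraMap ℤ_[p] 𝒪 (x k) with hxs
  set xsl : 𝒪 := algebraMap ℤ_[p] 𝒪 xlim with hxsl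
  have hxs_mem : ∀ k, xs k ∈ IsLocalRing.maximalIdeal 𝒪 := fun k => hpt _ (hxk k)
  have hxsl_mem : xsl ∈ IsLocalRing.maximalIdeal 𝒪 := hpt _ hxlim
  have hdiff : ∀ m : ℕ, ∀ᶠ k in atTop, ((p : ℕ) : 𝒪) ^ m ∣ xs k - xsl := by
    intro m
    filter_upwards [eventually_pow_dvd_sub x xlim hconv m] with k hk
    have := map_dvd (algebraMap ℤ_[p] 𝒪) hk
    simpa [map_pow, map_natCast, map_sub] using this
  -- fibres: notation
  set Finf := EvAt xsl hxsl_mem F with hFinf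
  set Linf := EvAt xsl hxsl_mem L with hLinf
  -- uniform convergence of fibres: `C(C(p^m)) ∣ Ev_k H - Ev_∞ H` once `p^m ∣ xs k - xsl`
  have hfib : ∀ (m k : ℕ), ((p : ℕ) : 𝒪) ^ m ∣ xs k - xsl →
      ∀ H : PowerSeries (PowerSeries (PowerSeries 𝒪)),
        PowerSeries.C (PowerSeries.C (((p : ℕ) : 𝒪) ^ m)) ∣
          EvAt (xs k) (hxs_mem k) H - EvAt xsl hxsl_mem H := by
    intro m k hk H
    rw [C_C_dvd_iff_forall_co_dvd]
    intro i j
    rw [co, map_sub, map_sub, ← co, ← co, co_EvAt, co_EvAt]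
    exact hk.trans (sub_dvd_evAt_sub_evAt _ _ (hxs_mem k) hxsl_mem _)
  -- solvability of `Finf · Z = p^c · Linf` modulo every `p^m`
  have hsol : ∀ m : ℕ, ∃ Z : PowerSeries (PowerSeries 𝒪),
      PowerSeries.C (PowerSeries.C (((p : ℕ) : 𝒪) ^ m)) ∣
        Finf * Z - PowerSeries.C (PowerSeries.C (((p : ℕ) : 𝒪) ^ c)) * Linf := by
    intro m
    obtain ⟨k, hk⟩ := (hdiff m).exists
    obtain ⟨G, U, hGU⟩ := hmem k
    have e1 : EvAt (xs k) (hxs_mem k) (PowerSeries.C (PowerSeries.C (PowerSeries.C (((p : ℕ) : 𝒪) ^ c)))) =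
        PowerSeries.C (PowerSeries.C (((p : ℕ) : 𝒪) ^ c)) := by
      rw [EvAt_C_C, evAt_C]
    have e3 : EvAt (xs k) (hxs_mem k)
        (PowerSeries.C (PowerSeries.C (PowerSeries.X - PowerSeries.C (algebraMap ℤ_[p] 𝒪 (x k))))) = 0 := by
      rw [EvAt_C_C, map_sub, evAt_X, evAt_C,
        show xs k - algebraMap ℤ_[p] 𝒪 (x k) = 0 from sub_self _, map_zero, map_zero]
    have hEv := congrArg (EvAt (xs k) (hxs_mem k)) hGU
    simp only [map_mul, map_add, e1, e3, zero_mul, add_zero] at hEv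
    -- hEv : C(C(p^c)) * Ev_k L = Ev_k F * Ev_k G
    refine ⟨EvAt (xs k) (hxs_mem k) G, ?_⟩
    have hF := hfib m k hk F
    have hL := hfib m k hk L
    have key : Finf * EvAt (xs k) (hxs_mem k) G -
        PowerSeries.C (PowerSeries.C (((p : ℕ) : 𝒪) ^ c)) * Linf =
        -((EvAt (xs k) (hxs_mem k) F - Finf) * EvAt (xs k) (hxs_mem k) G) +
          PowerSeries.C (PowerSeries.C (((p : ℕ) : 𝒪) ^ c)) * (EvAt (xs k) (hxs_mem k) L - Linf) := by
      rw [mul_sub, hEv]; ring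
    rw [key]
    exact dvd_add (dvd_neg.mpr (dvd_mul_of_dvd_left hF _)) (dvd_mul_of_dvd_right hL _)
  obtain ⟨Z, hZ⟩ := exists_mul_eq_of_forall_exists_mod ((p : ℕ) : 𝒪) hp Finf _ hsol
  -- lift Z to the three-variable ring and read off the remainder
  set G := PowerSeries.map (PowerSeries.map (PowerSeries.C (R := 𝒪))) Z with hG
  have hEvG : EvAt xsl hxsl_mem G = Z := EvAt_lift xsl hxsl_mem Z
  have hrem : EvAt xsl hxsl_mem
      (PowerSeries.C (PowerSeries.C (PowerSeries.C (((p : ℕ) : 𝒪) ^ c))) * L - F * G) = 0 := by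
    rw [map_sub, map_mul, map_mul, EvAt_C_C, evAt_C, hEvG, ← hFinf, ← hLinf, hZ, sub_self]
  obtain ⟨U, hU⟩ := C_C_dvd_of_EvAt_eq_zero xsl hxsl_mem _ hrem
  exact ⟨G, U, by rw [← hU]; ring⟩

/-- **`AccumulationLemma₂U` is a theorem** (both conjuncts): U₁ gives the nondegeneracy, U₂ the divisibility. -/
theorem uniform_variant_holds {p : ℕ} [Fact p.Prime]
    (𝒪 : Type*) [CommRing 𝒪] [IsDomain 𝒪] [IsDiscreteValuationRing 𝒪] [Algebra ℤ_[p] 𝒪]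
    [IsAdicComplete (IsLocalRing.maximalIdeal 𝒪) 𝒪] (hp : Irreducible ((p : ℕ) : 𝒪))
    (F L : PowerSeries (PowerSeries (PowerSeries 𝒪))) (x : ℕ → ℤ_[p]) (xlim : ℤ_[p]) (c : ℕ)
    (hxk : ∀ k, ‖x k‖ < 1) (hxlim : ‖xlim‖ < 1)
    (hconv : Tendsto x atTop (nhds xlim))
    (hmem : ∀ k, ∃ G U : PowerSeries (PowerSeries (PowerSeries 𝒪)),
      PowerSeries.C (PowerSeries.C (PowerSeries.C (((p : ℕ) : 𝒪) ^ c))) * L =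
        F * G + PowerSeries.C (PowerSeries.C (PowerSeries.X - PowerSeries.C (algebraMap ℤ_[p] 𝒪 (x k)))) * U)
    (hL : ¬ (PowerSeries.C (PowerSeries.C (PowerSeries.X - PowerSeries.C (algebraMap ℤ_[p] 𝒪 xlim))) ∣ L)) :
    ¬ (PowerSeries.C (PowerSeries.C (PowerSeries.X - PowerSeries.C (algebraMap ℤ_[p] 𝒪 xlim))) ∣ F) ∧
    ∃ (a : ℕ) (G U : PowerSeries (PowerSeries (PowerSeries 𝒪))),
      PowerSeries.C (PowerSeries.C (PowerSeries.C (((p : ℕ) : 𝒪) ^ a))) * L =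
        F * G + PowerSeries.C (PowerSeries.C (PowerSeries.X - PowerSeries.C (algebraMap ℤ_[p] 𝒪 xlim))) * U :=
  ⟨not_dvd_of_uniform_members 𝒪 hp F L x xlim c hxk hxlim hconv hmem hL,
   c, dvd_limit_of_uniform_members 𝒪 hp F L x xlim c hxk hxlim hconv hmem⟩

end Uniform2

/-! ### Theorem P: the VARYING-constant accumulation lemma itself — no UFD needed either.
Content decomposition of the limit fibres + non-zero-divisor cancellation turn the member identities into EXACT
fibre identities `F'_k · W_k = L'_k` for the unit-content parts, and the solving lemma finishes. -/

section Plain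

open Filter

/-- content decomposition in `𝒪⟦T₂⟧⟦T₁⟧` over a DVR: `A = π^b · A'` with `A'` of unit content. -/
lemma exists_eq_C_C_pow_mul_not_dvd {𝒪 : Type*} [CommRing 𝒪] [IsDomain 𝒪] [IsDiscreteValuationRing 𝒪]
    (π : 𝒪) (hπ : Irreducible π) (A : PowerSeries (PowerSeries 𝒪)) (hA : A ≠ 0) :
    ∃ (b : ℕ) (A' : PowerSeries (PowerSeries 𝒪)),
      A = PowerSeries.C (PowerSeries.C (π ^ b)) * A' ∧ ¬ PowerSeries.C (PowerSeries.C π) ∣ A' := by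
  classical
  obtain ⟨i₀, j₀, hd⟩ : ∃ i j, co i j A ≠ 0 := by
    by_contra hall
    push Not at hall
    exact hA (eq_zero_of_co_eq_zero A hall)
  have hex : ∃ n : ℕ, ∃ i j, ¬ π ^ (n + 1) ∣ co i j A := by
    obtain ⟨N, hN⟩ := finite_pow_dvd_of_dvr π hπ _ hd
    rcases N with _ | n
    · exact absurd (by simp) hN
    · exact ⟨n, i₀, j₀, hN⟩
  let b := Nat.find hex
  obtain ⟨i₁, j₁, hb⟩ : ∃ i j, ¬ π ^ (b + 1) ∣ co i j A := Nat.find_spec hex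
  have hball : ∀ i j, π ^ b ∣ co i j A := by
    intro i j
    rcases Nat.eq_zero_or_pos b with h0 | hpos
    · rw [h0, pow_zero]; exact one_dvd _
    · have hmin := Nat.find_min hex (m := b - 1) (by omega)
      push Not at hmin
      have := hmin i j
      rwa [Nat.sub_add_cancel hpos] at this
  obtain ⟨A', hA'⟩ := (C_C_dvd_iff_forall_co_dvd (π ^ b) A).mpr hball
  refine ⟨b, A', hA', ?_⟩
  intro h
  apply hb
  have h' := (C_C_dvd_iff_forall_co_dvd π A').mp h i₁ j₁
  rw [hA', co_C_C_mul, pow_succ]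
  exact mul_dvd_mul_left _ h'

/-- **Theorem P** (`AccumulationLemma₂` with its quantifiers opened): VARYING member constants `p^{c_k}`,
nondegenerate limit fibre of `F` ⟹ `p^a·L ∈ (F, [X − x_∞])`. -/
theorem dvd_limit_of_members {p : ℕ} [Fact p.Prime]
    (𝒪 : Type*) [CommRing 𝒪] [IsDomain 𝒪] [IsDiscreteValuationRing 𝒪] [Algebra ℤ_[p] 𝒪]
    [IsAdicComplete (IsLocalRing.maximalIdeal 𝒪) 𝒪] (hp : Irreducible ((p : ℕ) : 𝒪))
    (F L : PowerSeries (PowerSeries (PowerSeries 𝒪))) (x : ℕ → ℤ_[p]) (xlim : ℤ_[p]) (c : ℕ → ℕ)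
    (hxk : ∀ k, ‖x k‖ < 1) (hxlim : ‖xlim‖ < 1)
    (hconv : Tendsto x atTop (nhds xlim))
    (hmem : ∀ k, ∃ G U : PowerSeries (PowerSeries (PowerSeries 𝒪)),
      PowerSeries.C (PowerSeries.C (PowerSeries.C (((p : ℕ) : 𝒪) ^ c k))) * L =
        F * G + PowerSeries.C (PowerSeries.C (PowerSeries.X - PowerSeries.C (algebraMap ℤ_[p] 𝒪 (x k)))) * U)
    (hF : ¬ (PowerSeries.C (PowerSeries.C (PowerSeries.X - PowerSeries.C (algebraMap ℤ_[p] 𝒪 xlim))) ∣ F)) :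
    ∃ (a : ℕ) (G U : PowerSeries (PowerSeries (PowerSeries 𝒪))),
      PowerSeries.C (PowerSeries.C (PowerSeries.C (((p : ℕ) : 𝒪) ^ a))) * L =
        F * G + PowerSeries.C (PowerSeries.C (PowerSeries.X - PowerSeries.C (algebraMap ℤ_[p] 𝒪 xlim))) * U := by
  classical
  have hprime : Prime ((p : ℕ) : 𝒪) := hp.prime
  have hpmem : ((p : ℕ) : 𝒪) ∈ IsLocalRing.maximalIdeal 𝒪 :=
    (IsLocalRing.mem_maximalIdeal _).mpr hp.not_isUnit
  have hpt : ∀ z : ℤ_[p], ‖z‖ < 1 → algebraMap ℤ_[p] 𝒪 z ∈ IsLocalRing.maximalIdeal 𝒪 := by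
    intro z hz
    obtain ⟨y, hy⟩ := (PadicInt.norm_lt_one_iff_dvd z).mp hz
    rw [hy, map_mul, map_natCast]
    exact Ideal.mul_mem_right _ _ hpmem
  set xs : ℕ → 𝒪 := fun k => algebraMap ℤ_[p] 𝒪 (x k) with hxs
  set xsl : 𝒪 := algebraMap ℤ_[p] 𝒪 xlim with hxsl
  have hxs_mem : ∀ k, xs k ∈ IsLocalRing.maximalIdeal 𝒪 := fun k => hpt _ (hxk k)
  have hxsl_mem : xsl ∈ IsLocalRing.maximalIdeal 𝒪 := hpt _ hxlim
  have hdiff : ∀ m : ℕ, ∀ᶠ k in atTop, ((p : ℕ) : 𝒪) ^ m ∣ xs k - xsl := by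
    intro m
    filter_upwards [eventually_pow_dvd_sub x xlim hconv m] with k hk
    have := map_dvd (algebraMap ℤ_[p] 𝒪) hk
    simpa [map_pow, map_natCast, map_sub] using this
  set Finf := EvAt xsl hxsl_mem F with hFinf
  set Linf := EvAt xsl hxsl_mem L with hLinf
  have hfib : ∀ (m k : ℕ), ((p : ℕ) : 𝒪) ^ m ∣ xs k - xsl →
      ∀ H : PowerSeries (PowerSeries (PowerSeries 𝒪)),
        PowerSeries.C (PowerSeries.C (((p : ℕ) : 𝒪) ^ m)) ∣
          EvAt (xs k) (hxs_mem k) H - EvAt xsl hxsl_mem H := by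
    intro m k hk H
    rw [C_C_dvd_iff_forall_co_dvd]
    intro i j
    rw [co, map_sub, map_sub, ← co, ← co, co_EvAt, co_EvAt]
    exact hk.trans (sub_dvd_evAt_sub_evAt _ _ (hxs_mem k) hxsl_mem _)
  have hCne : ∀ m : ℕ, (PowerSeries.C (PowerSeries.C (((p : ℕ) : 𝒪) ^ m)) : PowerSeries (PowerSeries 𝒪)) ≠ 0 := by
    intro m h0
    have := congrArg (fun G => co 0 0 G) h0
    simp only [co, PowerSeries.coeff_zero_eq_constantCoeff_apply, PowerSeries.constantCoeff_C,
      map_zero] at this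
    exact pow_ne_zero _ hp.ne_zero this
  -- the fibre identities
  have hfibre : ∀ k, ∃ Q : PowerSeries (PowerSeries 𝒪),
      PowerSeries.C (PowerSeries.C (((p : ℕ) : 𝒪) ^ c k)) * EvAt (xs k) (hxs_mem k) L =
        EvAt (xs k) (hxs_mem k) F * Q := by
    intro k
    obtain ⟨G, U, hGU⟩ := hmem k
    have e1 : EvAt (xs k) (hxs_mem k) (PowerSeries.C (PowerSeries.C (PowerSeries.C (((p : ℕ) : 𝒪) ^ c k)))) =
        PowerSeries.C (PowerSeries.C (((p : ℕ) : 𝒪) ^ c k)) := by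
      rw [EvAt_C_C, evAt_C]
    have e3 : EvAt (xs k) (hxs_mem k)
        (PowerSeries.C (PowerSeries.C (PowerSeries.X - PowerSeries.C (algebraMap ℤ_[p] 𝒪 (x k))))) = 0 := by
      rw [EvAt_C_C, map_sub, evAt_X, evAt_C,
        show xs k - algebraMap ℤ_[p] 𝒪 (x k) = 0 from sub_self _, map_zero, map_zero]
    have hEv := congrArg (EvAt (xs k) (hxs_mem k)) hGU
    simp only [map_mul, map_add, e1, e3, zero_mul, add_zero] at hEv
    exact ⟨_, hEv⟩
  choose Q hQ using hfibre
  -- case L(x_∞) = 0 : trivial conclusion with a = 0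
  by_cases hL0 : Linf = 0
  · obtain ⟨U, hU⟩ := C_C_dvd_of_EvAt_eq_zero xsl hxsl_mem L hL0
    exact ⟨0, 0, U, by rw [pow_zero, map_one, map_one, map_one, one_mul, mul_zero, zero_add]; exact hU⟩
  -- F(x_∞) ≠ 0 by nondegeneracy
  have hF0 : Finf ≠ 0 := fun h0 => hF (C_C_dvd_of_EvAt_eq_zero xsl hxsl_mem F h0)
  -- content decompositions of the two limit fibres
  obtain ⟨b, F', hF', hF'nd⟩ := exists_eq_C_C_pow_mul_not_dvd ((p : ℕ) : 𝒪) hp Finf hF0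
  obtain ⟨e, L', hL', hL'nd⟩ := exists_eq_C_C_pow_mul_not_dvd ((p : ℕ) : 𝒪) hp Linf hL0
  -- solvability of F'·Z ≡ L' modulo every p^j
  have hsol : ∀ j : ℕ, ∃ Z : PowerSeries (PowerSeries 𝒪),
      PowerSeries.C (PowerSeries.C (((p : ℕ) : 𝒪) ^ j)) ∣ F' * Z - L' := by
    intro j
    set n := j + b + e + 1 with hn
    obtain ⟨k, hk⟩ := (hdiff n).exists
    -- F_k = p^b · F'_k with F'_k ≡ F' (mod p^(j+e+1)), unit content
    obtain ⟨D₁, hD₁⟩ := hfib n k hk F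
    obtain ⟨D₂, hD₂⟩ := hfib n k hk L
    set F'k := F' + PowerSeries.C (PowerSeries.C (((p : ℕ) : 𝒪) ^ (j + e + 1))) * D₁ with hF'k
    set L'k := L' + PowerSeries.C (PowerSeries.C (((p : ℕ) : 𝒪) ^ (j + b + 1))) * D₂ with hL'k
    have hFk : EvAt (xs k) (hxs_mem k) F = PowerSeries.C (PowerSeries.C (((p : ℕ) : 𝒪) ^ b)) * F'k := by
      have : EvAt (xs k) (hxs_mem k) F = Finf + PowerSeries.C (PowerSeries.C (((p : ℕ) : 𝒪) ^ n)) * D₁ := by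
        rw [← hD₁]; ring
      rw [this, hF', hF'k, hn, show j + b + e + 1 = b + (j + e + 1) by ring, pow_add, map_mul, map_mul]
      ring
    have hLk : EvAt (xs k) (hxs_mem k) L = PowerSeries.C (PowerSeries.C (((p : ℕ) : 𝒪) ^ e)) * L'k := by
      have : EvAt (xs k) (hxs_mem k) L = Linf + PowerSeries.C (PowerSeries.C (((p : ℕ) : 𝒪) ^ n)) * D₂ := by
        rw [← hD₂]; ring
      rw [this, hL', hL'k, hn, show j + b + e + 1 = e + (j + b + 1) by ring, pow_add, map_mul, map_mul]
      ring
    have hF'knd : ¬ PowerSeries.C (PowerSeries.C ((p : ℕ) : 𝒪)) ∣ F'k := by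
      intro h
      apply hF'nd
      have h2 : PowerSeries.C (PowerSeries.C ((p : ℕ) : 𝒪)) ∣
          PowerSeries.C (PowerSeries.C (((p : ℕ) : 𝒪) ^ (j + e + 1))) * D₁ := by
        refine dvd_mul_of_dvd_left ?_ _
        rw [C_C_pow]; exact dvd_pow_self _ (by omega)
      have := dvd_sub h h2
      rwa [hF'k, add_sub_cancel_right] at this
    -- member identity at k : p^(c k + e) · L'k = p^b · F'k · Q k
    have hid : PowerSeries.C (PowerSeries.C (((p : ℕ) : 𝒪) ^ (c k + e))) * L'k =
        F'k * (PowerSeries.C (PowerSeries.C (((p : ℕ) : 𝒪) ^ b)) * Q k) := by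
      have := hQ k
      rw [hLk, hFk] at this
      rw [pow_add, map_mul, map_mul]
      calc PowerSeries.C (PowerSeries.C (((p : ℕ) : 𝒪) ^ c k)) * PowerSeries.C (PowerSeries.C (((p : ℕ) : 𝒪) ^ e)) * L'k
          = PowerSeries.C (PowerSeries.C (((p : ℕ) : 𝒪) ^ c k)) * (PowerSeries.C (PowerSeries.C (((p : ℕ) : 𝒪) ^ e)) * L'k) := by ring
        _ = PowerSeries.C (PowerSeries.C (((p : ℕ) : 𝒪) ^ b)) * F'k * Q k := this
        _ = F'k * (PowerSeries.C (PowerSeries.C (((p : ℕ) : 𝒪) ^ b)) * Q k) := by ring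
    -- cancel: p^(c k + e) ∣ p^b · Q k since F'k is a non-zero-divisor mod p-powers
    have hdvd : PowerSeries.C (PowerSeries.C (((p : ℕ) : 𝒪) ^ (c k + e))) ∣
        PowerSeries.C (PowerSeries.C (((p : ℕ) : 𝒪) ^ b)) * Q k :=
      C_C_pow_dvd_of_dvd_mul ((p : ℕ) : 𝒪) hprime F'k hF'knd (c k + e) _ ⟨L'k, hid.symm⟩
    obtain ⟨W, hW⟩ := hdvd
    have hexact : F'k * W = L'k := by
      apply mul_left_cancel₀ (hCne (c k + e))
      rw [hid, hW]; ring
    refine ⟨W, ?_⟩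
    have key : F' * W - L' = -(PowerSeries.C (PowerSeries.C (((p : ℕ) : 𝒪) ^ (j + e + 1))) * D₁ * W) +
        PowerSeries.C (PowerSeries.C (((p : ℕ) : 𝒪) ^ (j + b + 1))) * D₂ := by
      have hF'eq : F' = F'k - PowerSeries.C (PowerSeries.C (((p : ℕ) : 𝒪) ^ (j + e + 1))) * D₁ := by
        rw [hF'k]; ring
      have hL'eq : L' = L'k - PowerSeries.C (PowerSeries.C (((p : ℕ) : 𝒪) ^ (j + b + 1))) * D₂ := by
        rw [hL'k]; ring
      rw [hF'eq, hL'eq, ← hexact]; ring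
    rw [key]
    refine dvd_add (dvd_neg.mpr (dvd_mul_of_dvd_left (dvd_mul_of_dvd_left ?_ _) _)) (dvd_mul_of_dvd_left ?_ _)
    · rw [C_C_pow, C_C_pow]; exact pow_dvd_pow _ (by omega)
    · rw [C_C_pow, C_C_pow]; exact pow_dvd_pow _ (by omega)
  obtain ⟨Z, hZ⟩ := exists_mul_eq_of_forall_exists_mod ((p : ℕ) : 𝒪) hp F' L' hsol
  -- F(x_∞) · (p^e Z) = p^b · L(x_∞)
  have hZ' : Finf * (PowerSeries.C (PowerSeries.C (((p : ℕ) : 𝒪) ^ e)) * Z) =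
      PowerSeries.C (PowerSeries.C (((p : ℕ) : 𝒪) ^ b)) * Linf := by
    rw [hF', hL', mul_assoc, ← mul_assoc F', mul_comm F', mul_assoc, hZ]
  set G := PowerSeries.map (PowerSeries.map (PowerSeries.C (R := 𝒪)))
    (PowerSeries.C (PowerSeries.C (((p : ℕ) : 𝒪) ^ e)) * Z) with hG
  have hEvG : EvAt xsl hxsl_mem G = PowerSeries.C (PowerSeries.C (((p : ℕ) : 𝒪) ^ e)) * Z :=
    EvAt_lift xsl hxsl_mem _
  have hrem : EvAt xsl hxsl_mem
      (PowerSeries.C (PowerSeries.C (PowerSeries.C (((p : ℕ) : 𝒪) ^ b))) * L - F * G) = 0 := by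
    rw [map_sub, map_mul, map_mul, EvAt_C_C, evAt_C, hEvG, ← hFinf, ← hLinf, hZ', sub_self]
  obtain ⟨U, hU⟩ := C_C_dvd_of_EvAt_eq_zero xsl hxsl_mem _ hrem
  exact ⟨b, G, U, by rw [← hU]; ring⟩

end Plain

/-! ### Consumer schema (critic V99 N1 — «name the consumer»): how `stub_twoVarRatDivPNew` APPLIES the lemma
The consumer is `stub_twoVarRatDivPNew` (§2). In its intended proof: `𝒪 = ℤ_p` (`Algebra ℤ_[p] ℤ_[p]`; or the Witt ring of a
finite field if the branch needs a coefficient extension), `X` = the weight variable of `f_E`'s Hida branch `𝕀` (étale over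
`Λ_wt` at the `p`-new weight-two point `x_∞`, so `𝕀 ≅ ℤ_p⟦X⟧` locally), `T₁, T₂` = the variables of `Λ₂ = ℤ_p⟦Γ_K⟧` for the
generator pair `(γ₁, γ)`; `F` = a characteristic power series of the family Greenberg Selmer dual `X_𝕀` over `𝕀⟦Γ_K⟧`
(unramified at `𝔭̄`); `L` = the family two-variable Greenberg / BDP `p`-adic `L`-function; `x_k` = the weights of the
crystalline members `g_k` (`x_k → x_∞` `p`-adically); `hmem` = INPUT (i), the member-wise rational two-variable
Beilinson–Flach Kolyvagin divisibilities `F(x_k) ∣ p^{c_k}·L(x_k)` written as ideal identities in `𝕀⟦Γ_K⟧`; `I` = the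
characteristic ideal `ch_{Λ₂}(X_Gr(f_E/K̃_∞))` (`WeierstrassCurve.XGr₂.charIdeal`, before the coefficient map `R1.toCpInt`);
`hcontrol` = INPUT (b′), control at the limit fibre up to `p^m` (`p^m·F(x_∞) ∈ I`); the OUTPUT `p^{c'}·L(x_∞) ∈ I` is the
`∃ L₂ c …` clause of `TwoVarRatDivPNew` with `L₂ := L(x_∞)` mapped to `𝓞_{ℂ_p}`-coefficients, and the explicit reciprocity
law at `x_∞` (`Castella2018Exceptional` Thms. 2.10–2.11, unit factor at `𝐍_K`) gives the `constantCoeff L₂ · u = p^e · Q` clause.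
Two versions: VARYING constants with the torsion INPUT `[X − x_∞] ∤ F` (from `accumulationLemma₂_holds`' engine), and UNIFORM
constant `c` with torsion as an OUTPUT and the explicit exponent `c' = m + c` (critic V99 N3: Theorem U₂ keeps `a = c`). -/

section Consumer

open Filter

theorem C_C_pow_mul_limit_mem_of_members {p : ℕ} [Fact p.Prime]
    (𝒪 : Type*) [CommRing 𝒪] [IsDomain 𝒪] [IsDiscreteValuationRing 𝒪] [Algebra ℤ_[p] 𝒪]
    [IsAdicComplete (IsLocalRing.maximalIdeal 𝒪) 𝒪] (hp : Irreducible ((p : ℕ) : 𝒪))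
    (F L : PowerSeries (PowerSeries (PowerSeries 𝒪))) (x : ℕ → ℤ_[p]) (xlim : ℤ_[p]) (c : ℕ → ℕ)
    (hxk : ∀ k, ‖x k‖ < 1) (hxlim : ‖xlim‖ < 1)
    (hconv : Tendsto x atTop (nhds xlim))
    (hmem : ∀ k, ∃ G U : PowerSeries (PowerSeries (PowerSeries 𝒪)),
      PowerSeries.C (PowerSeries.C (PowerSeries.C (((p : ℕ) : 𝒪) ^ c k))) * L =
        F * G + PowerSeries.C (PowerSeries.C (PowerSeries.X - PowerSeries.C (algebraMap ℤ_[p] 𝒪 (x k)))) * U)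
    (hF : ¬ (PowerSeries.C (PowerSeries.C (PowerSeries.X - PowerSeries.C (algebraMap ℤ_[p] 𝒪 xlim))) ∣ F))
    (hxl : algebraMap ℤ_[p] 𝒪 xlim ∈ IsLocalRing.maximalIdeal 𝒪)
    (I : Ideal (PowerSeries (PowerSeries 𝒪))) (m : ℕ)
    (hcontrol : PowerSeries.C (PowerSeries.C (((p : ℕ) : 𝒪) ^ m)) * EvAt (algebraMap ℤ_[p] 𝒪 xlim) hxl F ∈ I) :
    ∃ c' : ℕ, PowerSeries.C (PowerSeries.C (((p : ℕ) : 𝒪) ^ c')) * EvAt (algebraMap ℤ_[p] 𝒪 xlim) hxl L ∈ I := by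
  obtain ⟨a, G, U, hGU⟩ := dvd_limit_of_members 𝒪 hp F L x xlim c hxk hxlim hconv hmem hF
  refine ⟨m + a, ?_⟩
  have e1 : EvAt (algebraMap ℤ_[p] 𝒪 xlim) hxl
      (PowerSeries.C (PowerSeries.C (PowerSeries.C (((p : ℕ) : 𝒪) ^ a)))) =
      PowerSeries.C (PowerSeries.C (((p : ℕ) : 𝒪) ^ a)) := by
    rw [EvAt_C_C, evAt_C]
  have e3 : EvAt (algebraMap ℤ_[p] 𝒪 xlim) hxl
      (PowerSeries.C (PowerSeries.C (PowerSeries.X - PowerSeries.C (algebraMap ℤ_[p] 𝒪 xlim)))) = 0 := by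
    rw [EvAt_C_C, map_sub, evAt_X, evAt_C, sub_self, map_zero, map_zero]
  have hEv := congrArg (EvAt (algebraMap ℤ_[p] 𝒪 xlim) hxl) hGU
  simp only [map_mul, map_add, e1, e3, zero_mul, add_zero] at hEv
  -- hEv : C(C(p^a)) · L(x_∞) = F(x_∞) · Ev G
  have : PowerSeries.C (PowerSeries.C (((p : ℕ) : 𝒪) ^ (m + a))) * EvAt (algebraMap ℤ_[p] 𝒪 xlim) hxl L =
      (PowerSeries.C (PowerSeries.C (((p : ℕ) : 𝒪) ^ m)) * EvAt (algebraMap ℤ_[p] 𝒪 xlim) hxl F) *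
        EvAt (algebraMap ℤ_[p] 𝒪 xlim) hxl G := by
    rw [pow_add, map_mul, map_mul, mul_assoc, hEv, mul_assoc]
  rw [this]
  exact I.mul_mem_right _ hcontrol

/-- uniform-constant version: torsion (`F(x_∞) ≠ 0`) is an OUTPUT, from `[X − x_∞] ∤ L`. -/
theorem C_C_pow_mul_limit_mem_of_uniform_members {p : ℕ} [Fact p.Prime]
    (𝒪 : Type*) [CommRing 𝒪] [IsDomain 𝒪] [IsDiscreteValuationRing 𝒪] [Algebra ℤ_[p] 𝒪]
    [IsAdicComplete (IsLocalRing.maximalIdeal 𝒪) 𝒪] (hp : Irreducible ((p : ℕ) : 𝒪))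
    (F L : PowerSeries (PowerSeries (PowerSeries 𝒪))) (x : ℕ → ℤ_[p]) (xlim : ℤ_[p]) (c : ℕ)
    (hxk : ∀ k, ‖x k‖ < 1) (hxlim : ‖xlim‖ < 1)
    (hconv : Tendsto x atTop (nhds xlim))
    (hmem : ∀ k, ∃ G U : PowerSeries (PowerSeries (PowerSeries 𝒪)),
      PowerSeries.C (PowerSeries.C (PowerSeries.C (((p : ℕ) : 𝒪) ^ c))) * L =
        F * G + PowerSeries.C (PowerSeries.C (PowerSeries.X - PowerSeries.C (algebraMap ℤ_[p] 𝒪 (x k)))) * U)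
    (hL : ¬ (PowerSeries.C (PowerSeries.C (PowerSeries.X - PowerSeries.C (algebraMap ℤ_[p] 𝒪 xlim))) ∣ L))
    (hxl : algebraMap ℤ_[p] 𝒪 xlim ∈ IsLocalRing.maximalIdeal 𝒪)
    (I : Ideal (PowerSeries (PowerSeries 𝒪))) (m : ℕ)
    (hcontrol : PowerSeries.C (PowerSeries.C (((p : ℕ) : 𝒪) ^ m)) * EvAt (algebraMap ℤ_[p] 𝒪 xlim) hxl F ∈ I) :
    EvAt (algebraMap ℤ_[p] 𝒪 xlim) hxl F ≠ 0 ∧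
    PowerSeries.C (PowerSeries.C (((p : ℕ) : 𝒪) ^ (m + c))) * EvAt (algebraMap ℤ_[p] 𝒪 xlim) hxl L ∈ I := by
  have hF := not_dvd_of_uniform_members 𝒪 hp F L x xlim c hxk hxlim hconv hmem hL
  refine ⟨fun h0 => hF (C_C_dvd_of_EvAt_eq_zero _ hxl F h0), ?_⟩
  obtain ⟨G, U, hGU⟩ := dvd_limit_of_uniform_members 𝒪 hp F L x xlim c hxk hxlim hconv hmem
  have e1 : EvAt (algebraMap ℤ_[p] 𝒪 xlim) hxl
      (PowerSeries.C (PowerSeries.C (PowerSeries.C (((p : ℕ) : 𝒪) ^ c)))) =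
      PowerSeries.C (PowerSeries.C (((p : ℕ) : 𝒪) ^ c)) := by
    rw [EvAt_C_C, evAt_C]
  have e3 : EvAt (algebraMap ℤ_[p] 𝒪 xlim) hxl
      (PowerSeries.C (PowerSeries.C (PowerSeries.X - PowerSeries.C (algebraMap ℤ_[p] 𝒪 xlim)))) = 0 := by
    rw [EvAt_C_C, map_sub, evAt_X, evAt_C, sub_self, map_zero, map_zero]
  have hEv := congrArg (EvAt (algebraMap ℤ_[p] 𝒪 xlim) hxl) hGU
  simp only [map_mul, map_add, e1, e3, zero_mul, add_zero] at hEv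
  have : PowerSeries.C (PowerSeries.C (((p : ℕ) : 𝒪) ^ (m + c))) * EvAt (algebraMap ℤ_[p] 𝒪 xlim) hxl L =
      (PowerSeries.C (PowerSeries.C (((p : ℕ) : 𝒪) ^ m)) * EvAt (algebraMap ℤ_[p] 𝒪 xlim) hxl F) *
        EvAt (algebraMap ℤ_[p] 𝒪 xlim) hxl G := by
    rw [pow_add, map_mul, map_mul, mul_assoc, hEv, mul_assoc]
  rw [this]
  exact I.mul_mem_right _ hcontrol

end Consumer


end Lever

/-! **v1.4: no named library input remains.** The v1.2 documentary `def UFDInput` (unique factorisation in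
`𝒪⟦X⟧⟦T₂⟧⟦T₁⟧`) is DELETED — discharged: `AccumulationLemma₂` is proved below (`accumulationLemma₂_holds`) without it. -/

/-- **Kernel-checked reduction (sorry-free): the uniform variant follows from the plain lemma**, by
Theorem U₁ (`not_dvd_of_uniform_members`) supplying the nondegeneracy hypothesis `[X − x_∞] ∤ F`. -/
theorem accumulationLemma₂U_of_accumulationLemma₂ (p : ℕ) [Fact p.Prime]
    (h : AccumulationLemma₂ p) : AccumulationLemma₂U p := by
  intro 𝒪 _ _ _ _ hcomp hp F L x xlim c hxk hxlim hne hconv hmem hL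
  haveI := hcomp
  have hF : ¬ (PowerSeries.C (PowerSeries.C (PowerSeries.X -
      PowerSeries.C (algebraMap ℤ_[p] 𝒪 xlim))) ∣ F) :=
    not_dvd_of_uniform_members 𝒪 hp F L x xlim c hxk hxlim hconv hmem hL
  exact ⟨hF, h 𝒪 hcomp hp F L x xlim (fun _ => c) hxk hxlim hne hconv hmem hF⟩

/-- **`AccumulationLemma₂U p` HOLDS** (v1.3, sorry-free, axioms `propext`/`Classical.choice`/`Quot.sound`):
Theorem U₁ (`not_dvd_of_uniform_members`) + Theorem U₂ (`dvd_limit_of_uniform_members`). With a UNIFORM member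
constant NO unique-factorisation input and NO nondegeneracy hypothesis is needed — downward accumulation is the
solving lemma `exists_mul_eq_of_forall_exists_mod` (content decomposition `A = π^b·A'`, `A'` a non-zero-divisor
modulo every `π^m` because `(𝒪/π)⟦T₂⟧⟦T₁⟧` is a domain, so the approximate solutions are Cauchy; completeness of `𝒪`).
The hypotheses `x k ≠ xlim` and (for the divisibility conjunct) `[X − x_∞] ∤ L` of the `def` are not even used. -/
theorem accumulationLemma₂U_holds (p : ℕ) [Fact p.Prime] : AccumulationLemma₂U p := by
  intro 𝒪 _ _ _ _ hcomp hp F L x xlim c hxk hxlim _hne hconv hmem hL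
  haveI := hcomp
  exact uniform_variant_holds 𝒪 hp F L x xlim c hxk hxlim hconv hmem hL

/-- **`AccumulationLemma₂ p` HOLDS** (v1.4, sorry-free, axioms `propext`/`Classical.choice`/`Quot.sound`): Theorem P
`dvd_limit_of_members`. THE LEVER OF THIS LINE IS A KERNEL THEOREM IN FULL — varying member constants included — with
NO unique-factorisation input: content decomposition of the two limit fibres (`exists_eq_C_C_pow_mul_not_dvd`),
non-zero-divisor cancellation (`C_C_pow_dvd_of_dvd_mul`) turning each member identity near `x_∞` into an EXACT
unit-content fibre identity `F'_k·W_k = L'_k`, and the solving lemma `exists_mul_eq_of_forall_exists_mod`. The exponent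
produced is `a = ` the `p`-content of the limit fibre `F(x_∞)`. The hypothesis `x k ≠ xlim` is not used. -/
theorem accumulationLemma₂_holds (p : ℕ) [Fact p.Prime] : AccumulationLemma₂ p := by
  intro 𝒪 _ _ _ _ hcomp hp F L x xlim c hxk hxlim _hne hconv hmem hF
  haveI := hcomp
  exact dvd_limit_of_members 𝒪 hp F L x xlim c hxk hxlim hconv hmem hF

/-! ## §1 The sign-free two-variable intermediate `TwoVarRatDivPNew` -/

section TwoVar

variable (W : WeierstrassCurve ℚ) [W.IsElliptic] [W.IsGloballyMinimal] (p : ℕ) [Fact p.Prime]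

/-- **`TwoVarRatDivPNew W p` — rational two-variable Kolyvagin divisibility of a lift of the ♭-frame, at the
`p`-new point, SIGN-FREE.** Binders: those of `X2.NonsplitKolyvaginDivOnTreeIntOther W p` VERBATIM minus the sign
hypothesis, then a cyclotomic `κ₁ : ZpExtension K p` and `γ₁` with `(γ₁, γ)` an adapted generator pair of
`(κ₁, κ)` (`ZpExtension.IsTopGeneratorPair`: in particular `κ(γ₁) = 0`, so `T₁ = 0` is the `κ`-line and
`PowerSeries.constantCoeff` is the restriction to it). Conclusion: `X_Gr(E_K/K̃_∞)` (unramified above `𝔭̄`) is a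
finitely generated TORSION `Λ₂`-module (so that the tree's `Module.charIdeal` is the genuine product of height-one
primes, not its junk value `⊤`) and `∃ L₂ c e u`, `u` a unit of `𝓞_{ℂ_p}⟦T⟧`,
`p^c·L₂ ∈ ch_{Λ₂}(X_Gr(E_K/K̃_∞) unr. above 𝔭̄)·𝓞_{ℂ_p}⟦T₁⟧⟦T₂⟧` and `L₂(0,T)·u = p^e·Q`.
WHAT THE STATEMENT SAYS EXACTLY (critic V95 P2, paid v1.2 — decl name kept): since `L₂, c, e, u` are EXISTENTIAL, the
`∃`-clause is EQUIVALENT to «the `T₁ = 0` specialisation of (the `𝓞_{ℂ_p}`-extension of) `ch_{Λ₂}(X_Gr)` contains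
`p^{e'}·Q·u⁻¹` for some `e'` and some unit `u`», i.e. `π(ch_{Λ₂} X_Gr) ∣ p^{e'}·Q` up to a unit of `𝓞_{ℂ_p}⟦T⟧`
(given `p^c L₂ = ch·M`, put `T₁ = 0`; conversely lift `M(0,T)` constantly). So `L₂` is a WITNESS VARIABLE, not a pinned
two-variable `p`-adic `L`-function, and `TwoVarRatDivPNew` is «torsion of `X_Gr` + rational divisibility of its `κ`-LINE
characteristic series into the ♭-frame», nothing more. The PINNED version — `L₂` = the unit-normalised two-variable
Greenberg/BDP function of `f_E` over `K` (CGS Def. 2.4.3 shape at a `p`-new form, the `p`-adic limit of the members'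
along `f_E`'s étale branch; `κ`-line restriction = the ♭-frame up to `p^e·unit`: CGS prop. `comp-Lac` for members,
Castella JIMJ 2020 Thm. 1.4 / `Castella2018Exceptional` Thms. 2.10–2.11 in the limit) — would be the rational half of
Burungale–Castella–Skinner Conj. 4.1.2 at `p ‖ N`; it is what the intended PROOF produces (the accumulation lemma is
applied to that `L₂`), but the stub does not, and need not, pin it. HYPOTHESIS-SHAPED; nothing asserted. Print status:
NOT in print at a reducible `p ‖ N`
(two-variable divisibilities in print: BSTW arXiv:2409.01350 Thm. 10.5 and Yan–Zhu 2026 Thm. 4.2 carry `p ∤ 2N` and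
(irr); CGS 2025 Thm. 3.3.1 is weight 2, `p ∤ N`).
[cite: CastellaGrossiSkinner2025, Thm. 3.3.1 and its proof (arXiv:2303.04373v3 p. 18: Rubin's `Hyp(K_∞,V)` (i)(ii) in place of a big-image hypothesis) and Def. 2.4.3]
[cite: BurungaleCastellaSkinner2025, §2.1 (p. 6) and Conj. 4.1.2 (the module `X_Gr(E/K_∞)`)]
[cite: Castella2018Exceptional, Thm. 2.10 and Thm. 2.11 (arXiv:1507.04260 pp. 13–14)] -/
def TwoVarRatDivPNew : Prop :=
  ∀ (N : ℕ) [NeZero N] (K : Type) [Field K] [NumberField K] (Dt : ModularParametrizationData W N)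
    (H : HeegnerDatum N (NumberField.discr K)) (ιK : K →+* ℂ) (P : (W.baseChange K).toAffine.Point),
    CellC W p → W.conductorNorm ℤ = N →
    IsImaginaryQuadratic K → NumberField.discr K < -4 → SatisfiesHeegnerHypothesis N K →
    (W.quadraticTwist (NumberField.discr K : ℚ)).entireLFunction 1 ≠ 0 →
    WeierstrassCurve.Affine.Point.map ιK.toRatAlgHom P = heegnerPointComplex Dt H →
    ¬ (p : ℤ) ∣ Dt.c → ¬ IsOfFinAddOrder P →
    Odd (NumberField.discr K) →
    ∀ (κ : ZpExtension K p), κ.IsAnticyclotomic →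
      ∀ (γ : Field.absoluteGaloisGroup K) [Fact (κ.IsTopGenerator γ)]
        (𝔭 : HeightOneSpectrum (𝓞 K)), ((p : ℕ) : 𝓞 K) ∈ 𝔭.asIdeal →
        𝔭.asIdeal.ramificationIdx (𝓞 ℚ) = 1 → 𝔭.asIdeal.inertiaDeg (𝓞 ℚ) = 1 →
        ∀ (𝔭bar : HeightOneSpectrum (𝓞 K)), ((p : ℕ) : 𝓞 K) ∈ 𝔭bar.asIdeal → 𝔭bar ≠ 𝔭 →
          ((Ideal.span {(p : ℤ)}).primesOver (𝓞 K)).ncard = 2 →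
        ∀ (f : CuspForm (CongruenceSubgroup.Gamma0 N) 2), IsNewformOf W f →
          ∀ (ι' : PadicAlgCl p ≃+* ℂ),
            (∀ (w : InfinitePlace K) (k : 𝓞 K),
              k ∈ 𝔭.asIdeal ↔ ‖ι'.symm (w.embedding (k : K))‖ < 1) →
            ∀ (ΩK : ℂ) (Ωp : ℂ_[p]) (Q : PowerSeries 𝓞_ℂ_[p]), ΩK ≠ 0 → ‖Ωp‖ = 1 →
              R1.IsBDPLFunctionInt p ι' 𝔭 κ γ f ΩK Ωp Q →
              ∀ (κ₁ : ZpExtension K p), κ₁.IsCyclotomic →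
                ∀ (γ₁ : Field.absoluteGaloisGroup K) [Fact (ZpExtension.IsTopGeneratorPair κ₁ κ γ₁ γ)],
                  Module.Finite (IwasawaAlgebra₂ p) ((W.baseChange K).XGr₂ p κ₁ κ 𝔭bar γ₁ γ) ∧
                  Module.IsTorsion (IwasawaAlgebra₂ p) ((W.baseChange K).XGr₂ p κ₁ κ 𝔭bar γ₁ γ) ∧
                  ∃ (L₂ : PowerSeries (PowerSeries 𝓞_ℂ_[p])) (c e : ℕ) (u : PowerSeries 𝓞_ℂ_[p]),
                    IsUnit u ∧
                    PowerSeries.C (PowerSeries.C ((p : 𝓞_ℂ_[p]) ^ c)) * L₂ ∈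
                      (WeierstrassCurve.XGr₂.charIdeal (W.baseChange K) p κ₁ κ 𝔭bar γ₁ γ).map
                        (PowerSeries.map (PowerSeries.map (R1.toCpInt p))) ∧
                    PowerSeries.constantCoeff L₂ * u = PowerSeries.C ((p : 𝓞_ℂ_[p]) ^ e) * Q

end TwoVar

/-! ## §2 The seven stubs (five = b1 v12 VERBATIM) -/

/-- **stub_publishedFacts** [fact-grade; each conjunct a REGISTERED Literature `Prop` with its cite
tag, NONE of them proved in the tree at registration of v8.1]: the 16 still-unproved published inputs of the
class theorems — 15 of v5's 23 (GV 2000 λ/μ at a multiplicative prime; Wuthrich 2014 Thm 16; Stein–Wuthrich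
2013 Thm 6.1 both signs; Greenberg–Stevens; newform existence (modularity "Version L"); Poitou–Tate ×2;
Hsieh 2014 Thm 1; Gross–Zagier; Kolyvagin; rank = analytic rank ≤ 1; Hoffstein–Luo / BFH non-vanishing
twist; Mazur on the Manin constant; Cassels isogeny invariance) as ONE conjunction, AND the 16th: Castella
JIMJ 17 (2018) Thms. 2.10–2.11 at weight 2 in BDP 2013's display (`thm210_thm211_bdpDisplay_pNew`, p435419;
p ≥ 5, p ‖ N, a_p symbolic, no image hypothesis). REMOVED v8 → v8.1 because PROVED (supplied by name in
`BSDpOnCellC_of`): modular parametrisation data (⇐ newform existence,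
`nonempty_modularParametrizationData_iff_exists_isNewformOf_unconditional`), Tate's local Euler–Poincaré
characteristic (`X11b.LocBridge.localEulerPoincareCharacteristic_adicCompletionEP`), Brink's anticyclotomic lemma
(`ZpExtension.decomp_not_le_kerSubgroup_of_isAnticyclotomic_holds`), Edixhoven's integrality
(`ModularForms.edixhoven_optimalManinConstant_integral_holds`). REMOVED v7 → v8: Stein–Wuthrich 2013 §4.2
canonical heights at a split / non-split multiplicative p (`exists_isSplitMultCanonical_holds` p457358,
`exists_isMultCanonical_holds` p464598 — k5-c4 g3, via Silverman ATAEC V.3.2(b)(i) proved as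
`TateCurve.tate_thetaRelation`), `cd ≤ 2` (`fieldCdLE_two_of_numberField_holds`), Heegner-point rationality
(`heegnerPointComplex_mem_range_map_holds`). [cite: Hsieh2014, Thm. 1] [cite: GreenbergVatsal2000, Thm. (1.3)]
[cite: SteinWuthrich2013, Thm. 6.1] [cite: Castella2018Exceptional, Thm. 2.10 and Thm. 2.11 (arXiv:1507.04260 pp. 13–14)]
[cite: LiuZhangZhang2018, Thm. 1.5.1 and Remark 1.1.2 and Thm. 1.5.3 (Duke Math. J. 167 pp. 745–749)] -/
theorem stub_publishedFacts :
    ((lambdaMu_multiplicative_of_gvPar ∧ thm16_charIdeal_dvd_multiplicative_of_reducible ∧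
    thm61_splitMultiplicative ∧ thm61_nonsplitMultiplicative ∧
    (∀ (W : WeierstrassCurve ℚ) [W.IsElliptic] [W.IsGloballyMinimal] (p : ℕ) [Fact p.Prime],
      greenberg_stevens (W := W) (p := p)) ∧
    exists_isNewformOf ∧
    (∀ (K : Type) [Field K] [NumberField K], poitouTate_selmerStructure_duality K) ∧
    (∀ (K : Type) [Field K] [NumberField K], poitouTate_sha_tateDual K) ∧
    hsieh2014_exists_anticyclotomicPAdicLFunction ∧
    (∀ (N : ℕ) [NeZero N] (W : WeierstrassCurve ℚ) (K : Type) [Field K] [NumberField K],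
      gross_zagier N W K) ∧
    (∀ (N : ℕ) [NeZero N] (W : WeierstrassCurve ℚ) (K : Type) [Field K] [NumberField K],
      kolyvagin N W K) ∧
    rank_eq_analyticRank_of_analyticRank_le_one ∧ HoffsteinLuo1997_exists_twist_L_one_ne_zero ∧
    mazur_not_dvd_maninConstant_of_odd ∧ bsdRHS_eq_of_isIsogenous) ∧
    thm210_thm211_bdpDisplay_pNew) ∧
    LiuZhangZhang2018.thm151_thm153_modularCurve_heegnerVector := by
  sorry

/-- **stub_twoVarRatDivPNew** [NEW, the load-bearing stub of line «accum»: `CellC W p → TwoVarRatDivPNew W p` for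
every minimal elliptic `W` and prime `p`. Intended proof: `AccumulationLemma₂` (§0) ∘ (member-wise rational two-variable
Beilinson–Flach divisibility for the crystalline members `g_k`, good ordinary reducible, Rubin `Hyp(K̃_∞,V)` (i)(ii))
∘ (fibre control of the family Greenberg Selmer module on `f_E`'s étale branch) ∘ (analytic fibre, Castella). WHY IT
MIGHT FAIL: the member input over `K̃_∞` for weight `k > 2` at an Eisenstein prime is assembled from printed pieces
(KLZ17 §8–11 classes and reciprocity laws in geometric weights; Rubin's `ℤ_p^d`-machinery) but not printed as
stated; fibre control at the `p`-new point needs `H⁰`-vanishing / no-pseudo-null inputs at `p ‖ N` — the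
weight-direction control at weight two under Hypothesis (p-Ord) (good ordinary OR bad multiplicative `p`) is
Delbourgo's "vertical" control theory (Ch. VII §7.3, Ch. VIII §8.3, Ch. X Prop. 10.10 / Thm. 10.11, over `F^{cy}`,
residual irreducibility assumed "for simplicity" in Ch. X), whose split-multiplicative leading term is itself only
conjectural (Conj. 10.3: an extra zero of order `#S^{split}` AT the weight-two point — harmless for accumulation,
which only needs the fibre `F(x_∞, T₁, T₂) ≠ 0`, but a warning that local factors at `𝔭 | p` enter the fibre).
THE PRECISE CONTROL INPUT (critic V95 P3 / A66, narrowed and made explicit v1.2): (b′) the family Greenberg dual `X_𝕀`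
on `f_E`'s étale branch has NO pseudo-null `𝕀⟦Γ_K⟧`-submodule supported over the limit fibre `x_∞` off `V(p)` —
equivalently `ch_{R_∞}(X_𝕀[P_∞]) ∣ p^m` for the weight-two height-one prime `P_∞ = ([X − x_∞])` — exactly the clause
under which the algebraic fibres `F(x_k)` of `ch(X_𝕀)` control `ch(X_Gr(g_k))` up to BOUNDED `p`-powers (Ochiai 2006
Lemma 7.2 is the obstruction in general; Delbourgo VII–VIII/X is the genre, irreducibility assumed there); AND the
member constant's sources made explicit hypotheses of the member input rather than hidden: (u1) Galois level of the
members bounded near `x_∞` — the `Λ`-adic image contains a congruence subgroup `Γ_{A_0}(𝔞)` for a nonzero ideal `𝔞`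
with `P_∞ ∉ Supp 𝔞`. EXISTENCE of such an `𝔞` at a residually REDUCIBLE non-CM cuspidal Hida family IS IN PRINT:
Conti–Lang–Medvedovsky, Prop. 6.6 («Assume `ρ̄|_{G_{ℚ_p}}` is regular … Then `(t,d)` is `A_0`-full, and `Q(A_0)` contains
`Λ = ℤ_p⟦X⟧`», `ρ̄` = the SEMISIMPLIFICATION of the residual representation, reducible allowed; regularity at `G_{ℚ_p}` for
`ρ̄^{ss}|_{G_{ℚ_p}} = η̄⁻¹ω ⊕ η̄`, `η̄² = 1` (`a_p = ±1`), is «`ω` takes a value `≠ ±1`», i.e. `p ≥ 5`); what is NOT in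
print as needed is the POSITION of the level: `P_∞ ∉ Supp 𝔞` (Hida, Compositio 151 (2015) relates the Galois level to
Eisenstein / CM congruence power series — not held here; Hida, Invent. Math. 194 (2013) Thm. I concerns the image modulo
prime divisors OVER `(p)` only), to be carried as the explicit hypothesis it is; (u2) the remaining rational losses
(`H⁰(K̃_∞, A_{g_k})`, local/Tamagawa indices at `N⁻`, Euler-system normalisation) locally constant in `k` near `x_∞` —
and THEN the entire algebraic passage to the limit fibre is the kernel theorem `accumulationLemma₂U_holds` (v1.3: no UFD,
no nondegeneracy hypothesis) — OR carried as varying `c_k` (which `AccumulationLemma₂`, unlike its uniform sibling and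
unlike Büyükboduk–Lei Prop. 25,
tolerates — v1.4: ALSO a kernel theorem, `accumulationLemma₂_holds`, no UFD — then torsion of `X_Gr(f_E)` (the
nondegeneracy INPUT `[X − x_∞] ∤ F`) must come from elsewhere: the anticyclotomic line's Heegner Kolyvagin system gives
the coarse rank bound). EITHER WAY THE ALGEBRA IS CLOSED IN THE KERNEL; what this stub asks for is (i) + (b′) + (u1)/(u2).
HOW THIS STUB CONSUMES THE LEMMA (critic V99 N1, v1.5): §0a `C_C_pow_mul_limit_mem_of_members` (varying constants, torsion
input) / `C_C_pow_mul_limit_mem_of_uniform_members` (uniform constant `c`, torsion output, exponent `m + c`) — with `𝒪 = ℤ_p`,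
`F = ch(X_𝕀)`, `L` = the family BDP/Greenberg function, `I = ch_{Λ₂}(X_Gr(f_E/K̃_∞))`, `hmem` = (i), `hcontrol` = (b′); the
output `p^{c'}·L(x_∞) ∈ I` is this statement's `∃ L₂ c …` clause (`L₂ := L(x_∞)`), the `constantCoeff` clause is the explicit
reciprocity law at `x_∞`.]
[cite: CastellaGrossiSkinner2025, Thm. 3.3.1 (arXiv:2303.04373v3 p. 18)]
[cite: Delbourgo2008, Prop. 10.10 and Thm. 10.11 and Conj. 10.3 (LMS Lecture Note Ser. 356 pp. 228–239)]
[cite: Hida2012, Thm. I (Invent. Math. 194 (2013) pp. 1–40: image of Λ-adic Galois representations modulo p; doi:10.1007/s00222-012-0439-7)]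
[cite: ContiLangMedvedovsky2019, Prop. 6.6 and Thm. 1.4 (arXiv:1904.10519 pp. 5, 39; Math. Ann. (2023) doi:10.1007/s00208-021-02345-w)]
[cite: KingsLoefflerZerbes2017, Thm. 11.6.4 (Camb. J. Math. 5; arXiv:1503.02888 p. 100)]
[cite: Ochiai2006, Lemma 7.2 and Cor. 7.5 (Compositio Math. 142 pp. 1187–1189)]
[cite: Castella2018Exceptional, Thm. 2.10 and Thm. 2.11] -/
theorem stub_twoVarRatDivPNew :
    ∀ (W : WeierstrassCurve ℚ) [W.IsElliptic] [W.IsGloballyMinimal] (p : ℕ) [Fact p.Prime],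
      CellC W p → TwoVarRatDivPNew W p := by
  sorry

/-- **stub_acDescent** [NEW: descent of the two-variable rational divisibility to the anticyclotomic line, both signs —
`(∀ W p, CellC W p → TwoVarRatDivPNew W p) ⟹` the two clauses of the record's `stub_divRbeta`
(`X2.NonsplitKolyvaginDivOnTreeIntOther` / `X2.SplitKolyvaginDivOnTreeIntOther`). Content: restrict
`p^c·L₂ ∈ ch_{Λ₂}(X_Gr)·𝓞` along `T₁ = 0` (`PowerSeries.constantCoeff`), then
`p^{k'}·π(ch_{Λ₂} X_Gr(E_K/K̃_∞)) ⊆ ch_Λ(X_ac^∅(E_K) strict at 𝔭̄)` from: `X_Gr(E'_K/K̃_∞)[T₁]` finite for the isogenous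
member `E'` with `E'(K)[p] = 0` (exists on Cell C: both end members of the isogeny class `p`-torsion over `K` would put
`μ_p ⊂ K`), finite local errors at `w ∣ 𝔭̄p^∞` and `w ∣ N`, isogeny invariance of `ch_Λ` up to `p^j`. WHY IT MIGHT
FAIL: a nonzero pseudo-null `Λ₂`-submodule of `X_Gr` with `T₁`-torsion of positive `Λ`-rank at a `p ‖ N` Eisenstein
prime (Greenberg 2016 Prop. 4.1.1 is stated for good `p` under his (SUR)/(LEO) hypotheses).
SIGN BOOKKEEPING (critic V95 P4, written out v1.2 — why ONE sign-free statement serves BOTH signs of `stub_divRbeta`):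
ALGEBRAIC side, no exceptional divisor for either sign: over `K̃_∞` «unramified at `w ∣ 𝔭̄`» = «strict at `w ∣ 𝔭̄`»
(`K̃_{∞,w̄} ⊇ ℚ_p(μ_{p^∞})·ℚ_p^{nr,(p)}`, so `G_w/I_w` is pro-prime-to-`p` on the unramified `ℤ_p`-quotient and
`H¹(G_w/I_w, A^{I_w}) = 0`); in the descent `X_Gr/T₁ → X_ac(str 𝔭̄, ∅ 𝔭)` there is NO local term at `𝔭` (no condition
at either level), the strict term at `𝔭̄` is FINITE (`μ_{p^∞}`-coinvariants under `Γ₁^{loc}` acting through a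
nontrivial cyclotomic character; the Tate period `q_E` is not a `p`-power-torsion point of the abelian `ℤ_p²`-extension)
for split AND nonsplit `a_p = ±1`, the `v ∤ p` terms are finite, and the global kernel is `p`-power via the isogenous
`E'` with `E'(K)[p] = 0` — so `π(ch X_Gr)·ch(X_Gr[T₁]) ∼ ch(X_ac)` up to `p^j` for BOTH signs. ANALYTIC side: the
♭-frame of `f_E` itself has the UNIT interpolation factor `(1 − a_p p⁻¹)` at `𝐍_K` for `a_p = ±1`, `p ≥ 5` (tree fact
`thm210_thm211_bdpDisplay_pNew` BY NAME: `L_𝔭(f)(𝐍_K) = (1 − a_p p⁻¹)·log_{ω_E} P_K` up to a unit), so `Q(0) ∼ log P ≠ 0`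
and there is NO exceptional zero on the `κ`-line for either sign; the only sign-sensitive phenomenon is a possible
WEIGHT-direction exceptional zero of the FAMILY function at `X = x_∞` when `a_p = +1` (`Literature.Barriers.
BirchSwinnertonDyer.ExceptionalZero` genre, Castella 2018): if `L = [X − x_∞]^m·L♮` the member divisibilities read
`F(x_k) ∣ p^{c_k + m·v_p(x_k − x_∞)}·L♮(x_k)` — VARYING constants, which `AccumulationLemma₂` tolerates (and the exact /
uniform siblings do not); it lives entirely inside `stub_twoVarRatDivPNew`, not here.]
[cite: Ochiai2006, Def. 7.1 and Lemma 7.2 (Compositio Math. 142 pp. 1187–1188)]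
[cite: BurungaleCastellaSkinner2025, §2.1 and Thm. 4.1.3 (arXiv:2405.00270v2 pp. 6, 8)]
[cite: KellerYin2024, §5.1 (a)–(e) (arXiv:2402.12781v2) (shape only)] -/
theorem stub_acDescent :
    (∀ (W : WeierstrassCurve ℚ) [W.IsElliptic] [W.IsGloballyMinimal] (p : ℕ) [Fact p.Prime],
      CellC W p → TwoVarRatDivPNew W p) →
    (∀ (W : WeierstrassCurve ℚ) [W.IsElliptic] [W.IsGloballyMinimal] (p : ℕ) [Fact p.Prime],
      CellC W p → ¬ W.HasSplitMultiplicativeReductionAtPrime p → NonsplitKolyvaginDivOnTreeIntOther W p) ∧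
    (∀ (W : WeierstrassCurve ℚ) [W.IsElliptic] [W.IsGloballyMinimal] (p : ℕ) [Fact p.Prime],
      CellC W p → W.HasSplitMultiplicativeReductionAtPrime p → SplitKolyvaginDivOnTreeIntOther W p) := by
  sorry

/-- **stub_lemma511** [a NAMED PREPRINT FACT as stub: Keller–Yin arXiv:2402.12781v2 §5.1 Lemma 5.1.1 (TeX
L1744–1749), member-`f` half — `KellerYin2024.lemma511_imprimitive_isTorsion_muInvariant_eq_zero_mult_OPEN` VERBATIM
(typed by this seat, `Literature/…/KellerYin2024/MultiplicativeImprimitiveMuInvariant.lean`, p621903; lit desk T144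
FAITHFUL-as-declared, flags KY511-S / KYD-Sel / KY511-tors / KY511-h1): at `2 < p`, `Mult`, `Red`, `K` as in KY
§0.1, `vbar ∋ p`, `κ` anticyclotomic, `Sf` = places over `N_E` off `p`, the `Sf`-imprimitive dual
`AcSelmer.XAc (W.baseChange K) p κ vbar ↑Sf γ` is `Λ`-torsion with `μ = 0`. It supplies v11's `stub_muSelmer`
(p622336) and the torsion/`μ` half of the imprimitive cut (p622724). Flag KY511-h1: at members with a rational
`p`-torsion point the instance rests on Lemma 5.1.1 + KY's lattice-independence sentence L1070–1074. Closing it =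
proving Keller–Yin's Lemma 5.1.1 (the Greenberg–Vatsal/Keller–Yin imprimitive devissage) in the tree.]
[claim: KellerYin2024, status: under-review]
[cite: KellerYin2024, Lemma 5.1.1 (arXiv:2402.12781v2 §5.1 TeX L1744–1749), Thm. 1.4.1 (L1087–1098)] -/
theorem stub_lemma511 :
    Literature.NumberTheory.EllipticCurves.KellerYin2024.lemma511_imprimitive_isTorsion_muInvariant_eq_zero_mult_OPEN := by
  sorry

/-- **stub_muFrame** [the ANALYTIC half of the «μ = 0 pair», both signs: at every X2c datum, every ♭-frame
`Q ∈ 𝓞_{ℂ_p}⟦T⟧` of the BDP `p`-adic `L`-function at `(ι′, 𝔭)` (`R1.IsBDPLFunctionInt`, Hsieh's receptacle) HAS a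
first unit coefficient: `∃ m, ‖Q_m‖ = 1 ∧ ∀ i < m, ‖Q_i‖ < 1` — i.e. `μ(𝓛^BDP_𝔭) = 0` in the wide receptacle
(`StubC3MuLambdaInvariants.firstUnitCoeff_map_toCpInt_iff_mu_eq_zero_and_lam_eq` is the `ℤ_p`-dictionary). PRINT
STATUS: at a residually REDUCIBLE `p ‖ N` no printed statement (Hsieh 2014 Thm. B / Castella–Hsieh need `ρ̄`
irreducible; CGLS 2022 Thm. 2.2.2 / Keller–Yin Thm. 2.2.2 carry `p ∤ N`; Keller–Yin §5.1 (b) reaches `𝓛^S_f` mod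
`𝔪^m` through Castella's two-variable `p`-adic `L`-function instead).] [claim: KellerYin2024, status: under-review]
[cite: KellerYin2024, Thm. 2.2.2 and §5.1 (b) (arXiv:2402.12781v2) (shape only; nothing asserted)]
[cite: Hsieh2014, Thm. 1 and Thm. B (Doc. Math. 19)] -/
theorem stub_muFrame :
    (∀ (W : WeierstrassCurve ℚ) [W.IsElliptic] [W.IsGloballyMinimal] (p : ℕ) [Fact p.Prime],
      ∀ (N : ℕ) [NeZero N] (K : Type) [Field K] [NumberField K] (Dt : ModularParametrizationData W N)
        (H : HeegnerDatum N (NumberField.discr K)) (ιK : K →+* ℂ) (P : (W.baseChange K).toAffine.Point),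
        CellC W p → ¬ W.HasSplitMultiplicativeReductionAtPrime p → W.conductorNorm ℤ = N →
        IsImaginaryQuadratic K → NumberField.discr K < -4 → SatisfiesHeegnerHypothesis N K →
        (W.quadraticTwist (NumberField.discr K : ℚ)).entireLFunction 1 ≠ 0 →
        WeierstrassCurve.Affine.Point.map ιK.toRatAlgHom P = heegnerPointComplex Dt H →
        ¬ (p : ℤ) ∣ Dt.c → ¬ IsOfFinAddOrder P →
        Odd (NumberField.discr K) →
        ∀ (κ : ZpExtension K p), κ.IsAnticyclotomic →
          ∀ (γ : Field.absoluteGaloisGroup K) [Fact (κ.IsTopGenerator γ)]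
            (𝔭 : HeightOneSpectrum (𝓞 K)), ((p : ℕ) : 𝓞 K) ∈ 𝔭.asIdeal →
            𝔭.asIdeal.ramificationIdx (𝓞 ℚ) = 1 → 𝔭.asIdeal.inertiaDeg (𝓞 ℚ) = 1 →
            ∀ (𝔭bar : HeightOneSpectrum (𝓞 K)), ((p : ℕ) : 𝓞 K) ∈ 𝔭bar.asIdeal → 𝔭bar ≠ 𝔭 →
              ((Ideal.span {(p : ℤ)}).primesOver (𝓞 K)).ncard = 2 →
            ∀ (f : CuspForm (CongruenceSubgroup.Gamma0 N) 2), IsNewformOf W f →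
              ∀ (ι' : PadicAlgCl p ≃+* ℂ),
                (∀ (w : InfinitePlace K) (k : 𝓞 K),
                  k ∈ 𝔭.asIdeal ↔ ‖ι'.symm (w.embedding (k : K))‖ < 1) →
                ∀ (ΩK : ℂ) (Ωp : ℂ_[p]) (Q : PowerSeries 𝓞_ℂ_[p]), ΩK ≠ 0 → ‖Ωp‖ = 1 →
                  R1.IsBDPLFunctionInt p ι' 𝔭 κ γ f ΩK Ωp Q →
                    ∃ m : ℕ, ‖((PowerSeries.coeff m Q : 𝓞_ℂ_[p]) : ℂ_[p])‖ = 1 ∧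
                  ∀ i < m, ‖((PowerSeries.coeff i Q : 𝓞_ℂ_[p]) : ℂ_[p])‖ < 1) ∧
    (∀ (W : WeierstrassCurve ℚ) [W.IsElliptic] [W.IsGloballyMinimal] (p : ℕ) [Fact p.Prime],
      ∀ (N : ℕ) [NeZero N] (K : Type) [Field K] [NumberField K] (Dt : ModularParametrizationData W N)
        (H : HeegnerDatum N (NumberField.discr K)) (ιK : K →+* ℂ) (P : (W.baseChange K).toAffine.Point),
        CellC W p → W.HasSplitMultiplicativeReductionAtPrime p → W.conductorNorm ℤ = N →
        IsImaginaryQuadratic K → NumberField.discr K < -4 → SatisfiesHeegnerHypothesis N K →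
        (W.quadraticTwist (NumberField.discr K : ℚ)).entireLFunction 1 ≠ 0 →
        WeierstrassCurve.Affine.Point.map ιK.toRatAlgHom P = heegnerPointComplex Dt H →
        ¬ (p : ℤ) ∣ Dt.c → ¬ IsOfFinAddOrder P →
        Odd (NumberField.discr K) →
        ∀ (κ : ZpExtension K p), κ.IsAnticyclotomic →
          ∀ (γ : Field.absoluteGaloisGroup K) [Fact (κ.IsTopGenerator γ)]
            (𝔭 : HeightOneSpectrum (𝓞 K)), ((p : ℕ) : 𝓞 K) ∈ 𝔭.asIdeal →
            𝔭.asIdeal.ramificationIdx (𝓞 ℚ) = 1 → 𝔭.asIdeal.inertiaDeg (𝓞 ℚ) = 1 →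
            ∀ (𝔭bar : HeightOneSpectrum (𝓞 K)), ((p : ℕ) : 𝓞 K) ∈ 𝔭bar.asIdeal → 𝔭bar ≠ 𝔭 →
              ((Ideal.span {(p : ℤ)}).primesOver (𝓞 K)).ncard = 2 →
            ∀ (f : CuspForm (CongruenceSubgroup.Gamma0 N) 2), IsNewformOf W f →
              ∀ (ι' : PadicAlgCl p ≃+* ℂ),
                (∀ (w : InfinitePlace K) (k : 𝓞 K),
                  k ∈ 𝔭.asIdeal ↔ ‖ι'.symm (w.embedding (k : K))‖ < 1) →
                ∀ (ΩK : ℂ) (Ωp : ℂ_[p]) (Q : PowerSeries 𝓞_ℂ_[p]), ΩK ≠ 0 → ‖Ωp‖ = 1 →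
                  R1.IsBDPLFunctionInt p ι' 𝔭 κ γ f ΩK Ωp Q →
                    ∃ m : ℕ, ‖((PowerSeries.coeff m Q : 𝓞_ℂ_[p]) : ℂ_[p])‖ = 1 ∧
                  ∀ i < m, ‖((PowerSeries.coeff i Q : 𝓞_ℂ_[p]) : ℂ_[p])‖ < 1) := by
  sorry

/-- **stub_imprimitiveCount** [THE WALL on line b1, at the IMPRIMITIVE level, both signs: at every X2c datum, for
`Sf` = the places of `K` over `N_E` NOT over `p` (Keller–Yin's `S = Σ ∖ {v, v̄, ∞}`) and every `m` at which the ♭-frame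
`Q` has its first unit coefficient, `m + Σ_{w∈Sf} curveLocalLambda κ E_K w ≤ λ(X_ac^{Sf}(E_K[p^∞]) strict at 𝔭̄)` —
in print's currency `λ(𝓛^S_f) ≤ λ(𝔛^S_f)` with `𝓛^S_f := 𝓛_f · ∏_{w∈S} 𝒫_w(f)` (KY §0.2 L267–268) and
`λ𝒫_w(f) = curveLocalLambda` (tree D3 dictionary). From it + `stub_lemma511` the primitive wall `λ(𝓛) ≤ λ(X_ac^∅)`
(v11 `stub_lambdaLowerBound`) follows BY NAME (`StubC3ImprimitiveCut`, p622724), the f-side `S`-relaxation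
`λ(X^{Sf}) ≤ λ(X^∅) + Σ curveLocalLambda` being KERNEL at `p ‖ N` (p564629 + p620653). PRINT STATUS: the
`λ`-consequence of Keller–Yin Lemma 5.1.2 (`Char(𝔛^S_f)Λ^nr = (𝓛^S_f)`, L1750–1769, the imprimitive main
conjecture delivered by the Hida-family congruence limit) — PREPRINT, printed proof GAPPED at L1754 (kernel
counterexample `X2.KellerYinFreePartGap`, flag KYD-gap; the repair needs lattice congruences `T_{f_m}/ϖ^m ≅ T_f/ϖ^m`
for residually reducible `f`, not in print); on the GV/CGLS road it is [ALG-imp at `p ‖ N`] + [PWL-θ] + [Thm 2.2.2 at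
`p ‖ N`, unprinted] + Rubin–Hida. Inline (no `𝓛^S` object for Hsieh's receptacle), not a named fact.]
[claim: KellerYin2024, status: under-review]
[cite: KellerYin2024, Lemma 5.1.2 (L1750–1769), §0.2 L246 and L267–268, Thm. 1.5.1, Thm. 2.2.2 (arXiv:2402.12781v2) (shape only)]
[cite: GreenbergVatsal2000, §2 Prop. (2.4)] -/
theorem stub_imprimitiveCount :
    (∀ (W : WeierstrassCurve ℚ) [W.IsElliptic] [W.IsGloballyMinimal] (p : ℕ) [Fact p.Prime],
      ∀ (N : ℕ) [NeZero N] (K : Type) [Field K] [NumberField K] (Dt : ModularParametrizationData W N)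
        (H : HeegnerDatum N (NumberField.discr K)) (ιK : K →+* ℂ) (P : (W.baseChange K).toAffine.Point),
        CellC W p → ¬ W.HasSplitMultiplicativeReductionAtPrime p → W.conductorNorm ℤ = N →
        IsImaginaryQuadratic K → NumberField.discr K < -4 → SatisfiesHeegnerHypothesis N K →
        (W.quadraticTwist (NumberField.discr K : ℚ)).entireLFunction 1 ≠ 0 →
        WeierstrassCurve.Affine.Point.map ιK.toRatAlgHom P = heegnerPointComplex Dt H →
        ¬ (p : ℤ) ∣ Dt.c → ¬ IsOfFinAddOrder P →
        Odd (NumberField.discr K) →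
        ∀ (κ : ZpExtension K p), κ.IsAnticyclotomic →
          ∀ (γ : Field.absoluteGaloisGroup K) [Fact (κ.IsTopGenerator γ)]
            (𝔭 : HeightOneSpectrum (𝓞 K)), ((p : ℕ) : 𝓞 K) ∈ 𝔭.asIdeal →
            𝔭.asIdeal.ramificationIdx (𝓞 ℚ) = 1 → 𝔭.asIdeal.inertiaDeg (𝓞 ℚ) = 1 →
            ∀ (𝔭bar : HeightOneSpectrum (𝓞 K)), ((p : ℕ) : 𝓞 K) ∈ 𝔭bar.asIdeal → 𝔭bar ≠ 𝔭 →
              ((Ideal.span {(p : ℤ)}).primesOver (𝓞 K)).ncard = 2 →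
            ∀ (f : CuspForm (CongruenceSubgroup.Gamma0 N) 2), IsNewformOf W f →
              ∀ (ι' : PadicAlgCl p ≃+* ℂ),
                (∀ (w : InfinitePlace K) (k : 𝓞 K),
                  k ∈ 𝔭.asIdeal ↔ ‖ι'.symm (w.embedding (k : K))‖ < 1) →
                ∀ (ΩK : ℂ) (Ωp : ℂ_[p]) (Q : PowerSeries 𝓞_ℂ_[p]), ΩK ≠ 0 → ‖Ωp‖ = 1 →
                  R1.IsBDPLFunctionInt p ι' 𝔭 κ γ f ΩK Ωp Q →
                    ∀ (Sf : Finset (HeightOneSpectrum (𝓞 K))),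
                    (∀ w : HeightOneSpectrum (𝓞 K), w ∈ Sf ↔
                      (((W.conductorNorm ℤ : ℤ) : 𝓞 K) ∈ w.asIdeal ∧ ((p : ℕ) : 𝓞 K) ∉ w.asIdeal)) →
                    ∀ m : ℕ, ‖((PowerSeries.coeff m Q : 𝓞_ℂ_[p]) : ℂ_[p])‖ = 1 →
                      (∀ i < m, ‖((PowerSeries.coeff i Q : 𝓞_ℂ_[p]) : ℂ_[p])‖ < 1) →
                        m + ∑ w ∈ Sf, curveLocalLambda κ (W.baseChange K) w ≤
                          lambdaInvariant p (XAc (W.baseChange K) p κ 𝔭bar (↑Sf : Set (HeightOneSpectrum (𝓞 K))) γ)) ∧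
    (∀ (W : WeierstrassCurve ℚ) [W.IsElliptic] [W.IsGloballyMinimal] (p : ℕ) [Fact p.Prime],
      ∀ (N : ℕ) [NeZero N] (K : Type) [Field K] [NumberField K] (Dt : ModularParametrizationData W N)
        (H : HeegnerDatum N (NumberField.discr K)) (ιK : K →+* ℂ) (P : (W.baseChange K).toAffine.Point),
        CellC W p → W.HasSplitMultiplicativeReductionAtPrime p → W.conductorNorm ℤ = N →
        IsImaginaryQuadratic K → NumberField.discr K < -4 → SatisfiesHeegnerHypothesis N K →
        (W.quadraticTwist (NumberField.discr K : ℚ)).entireLFunction 1 ≠ 0 →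
        WeierstrassCurve.Affine.Point.map ιK.toRatAlgHom P = heegnerPointComplex Dt H →
        ¬ (p : ℤ) ∣ Dt.c → ¬ IsOfFinAddOrder P →
        Odd (NumberField.discr K) →
        ∀ (κ : ZpExtension K p), κ.IsAnticyclotomic →
          ∀ (γ : Field.absoluteGaloisGroup K) [Fact (κ.IsTopGenerator γ)]
            (𝔭 : HeightOneSpectrum (𝓞 K)), ((p : ℕ) : 𝓞 K) ∈ 𝔭.asIdeal →
            𝔭.asIdeal.ramificationIdx (𝓞 ℚ) = 1 → 𝔭.asIdeal.inertiaDeg (𝓞 ℚ) = 1 →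
            ∀ (𝔭bar : HeightOneSpectrum (𝓞 K)), ((p : ℕ) : 𝓞 K) ∈ 𝔭bar.asIdeal → 𝔭bar ≠ 𝔭 →
              ((Ideal.span {(p : ℤ)}).primesOver (𝓞 K)).ncard = 2 →
            ∀ (f : CuspForm (CongruenceSubgroup.Gamma0 N) 2), IsNewformOf W f →
              ∀ (ι' : PadicAlgCl p ≃+* ℂ),
                (∀ (w : InfinitePlace K) (k : 𝓞 K),
                  k ∈ 𝔭.asIdeal ↔ ‖ι'.symm (w.embedding (k : K))‖ < 1) →
                ∀ (ΩK : ℂ) (Ωp : ℂ_[p]) (Q : PowerSeries 𝓞_ℂ_[p]), ΩK ≠ 0 → ‖Ωp‖ = 1 →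
                  R1.IsBDPLFunctionInt p ι' 𝔭 κ γ f ΩK Ωp Q →
                    ∀ (Sf : Finset (HeightOneSpectrum (𝓞 K))),
                    (∀ w : HeightOneSpectrum (𝓞 K), w ∈ Sf ↔
                      (((W.conductorNorm ℤ : ℤ) : 𝓞 K) ∈ w.asIdeal ∧ ((p : ℕ) : 𝓞 K) ∉ w.asIdeal)) →
                    ∀ m : ℕ, ‖((PowerSeries.coeff m Q : 𝓞_ℂ_[p]) : ℂ_[p])‖ = 1 →
                      (∀ i < m, ‖((PowerSeries.coeff i Q : 𝓞_ℂ_[p]) : ℂ_[p])‖ < 1) →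
                        m + ∑ w ∈ Sf, curveLocalLambda κ (W.baseChange K) w ≤
                          lambdaInvariant p (XAc (W.baseChange K) p κ 𝔭bar (↑Sf : Set (HeightOneSpectrum (𝓞 K))) γ)) := by
  sorry

/-- **stub_mazurMC_cellB** := the route decl `MazurMCOnCellB` VERBATIM (crux 3,
stmt-BirchSwinnertonDyer-19033; RULING L5 (β)). [cite: GreenbergVatsal2000, Thm. (1.3)] -/
theorem stub_mazurMC_cellB :
    Summit.BirchSwinnertonDyer.BirchSwinnertonDyer.Theses.EisensteinPrimes.MazurMCOnCellB := by
  sorry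

/-- **ROAD R-β from the two new stubs** (kernel, one line): both clauses of the record's `stub_divRbeta`.
[cite: KellerYin2024, §3 and §5.2 (arXiv:2402.12781v2) (shape only)] -/
theorem divRbeta_of_accum :
    (∀ (W : WeierstrassCurve ℚ) [W.IsElliptic] [W.IsGloballyMinimal] (p : ℕ) [Fact p.Prime],
      CellC W p → ¬ W.HasSplitMultiplicativeReductionAtPrime p → NonsplitKolyvaginDivOnTreeIntOther W p) ∧
    (∀ (W : WeierstrassCurve ℚ) [W.IsElliptic] [W.IsGloballyMinimal] (p : ℕ) [Fact p.Prime],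
      CellC W p → W.HasSplitMultiplicativeReductionAtPrime p → SplitKolyvaginDivOnTreeIntOther W p) :=
  stub_acDescent stub_twoVarRatDivPNew

/-- **COMPOSITION — `BSDpOnCellC_of`: the seven stubs imply crux 4 BY NAME**
(`Summit.BirchSwinnertonDyer.BirchSwinnertonDyer.Theses.EisensteinPrimes.BSDpOnCellC` = `X2.TargetC`) through the record's
V11 closer `BSDpOnCellCResidualV11.bsdpOnCellC_of_publishedFacts_of_divIntOther_of_lemma511_OPEN_of_muFrame_of_imprimitiveCount_of_cellB`
with `divRbeta := stub_acDescent stub_twoVarRatDivPNew`. No sorry outside the stubs.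
[cite: KellerYin2024, Thm. 5.1.3 = Thm. D, Lemma 5.1.1, Lemma 5.1.2 (arXiv:2402.12781v2) (shape only)]
[cite: Castella2018Exceptional, Thm. 2.10 and Thm. 2.11] [cite: Hsieh2014, Thm. 1] -/
theorem BSDpOnCellC_of :
    Summit.BirchSwinnertonDyer.BirchSwinnertonDyer.Theses.EisensteinPrimes.BSDpOnCellC :=
  Summit.BirchSwinnertonDyer.BirchSwinnertonDyer.Theorems.BSDpOnCellCResidualV11.bsdpOnCellC_of_publishedFacts_of_divIntOther_of_lemma511_OPEN_of_muFrame_of_imprimitiveCount_of_cellB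
    stub_publishedFacts divRbeta_of_accum.1 divRbeta_of_accum.2 stub_lemma511 stub_muFrame.1 stub_muFrame.2
    stub_imprimitiveCount.1 stub_imprimitiveCount.2 stub_mazurMC_cellB

end Summit.BirchSwinnertonDyer.BirchSwinnertonDyer.Cruxes.BSDpOnCellC.Accum

end
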